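import Literature.MathematicalPhysics.QuantumFieldTheory.Balaban1983to89.B8Thm4MultiLevelTorus

/-!
# `Balaban1983to89.B8Thm8MultiLevelTorus` — T. Bałaban, *Spaces of regular gauge field configurations on a lattice and gauge fixing
# conditions*, Commun. Math. Phys. **99** (1985) 75–102 [Balaban1985RegularSpaces], Sect. H, **THEOREM 8** p. 101 (the gauge condition
# WITH A SOURCE, (1.146) `R(U₀)D^{η*}_{U₀}A = f`) — AT THE FLAT BACKGROUND `U₀ = 1`, in the linear (abelian) chart, ON PRINT'S OWN
# MULTI-LEVEL CARRIER: the `k`-LEVEL V1 TORUS `T_η = Ω₁ ⊃ Ω₂ ⊃ … ⊃ Ω_k` (every odd `L ≥ 5`, `k ≥ 1`, `P′ ≥ 5L`), HYPOTHESIS-FREE on the [B6]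
# side (rows **B8.Thm8**, **B8.Eq1.146** cells, and the `∂G′`-clause of p. 93 (1.101) on the V1 carrier — row **B8.Eq1.101** cell; heads unchanged)

statement-level skeleton of published theorems with citation tags; proofs where landed; nothing here is a claim about the Yang–Mills mass gap

PDF held: `paper:balaban1985-cmp99-regular-spaces-gauge-fixing` (journal page = PDF page + 74); p. 101 [PDF 27] read AS IMAGE this session
(render `run/shared/lean/pub/pub-balaban/b2b-balaban-ref1/pages/1985-cmp99-regular-spaces-gauge-fixing/1985-cmp99-regular-spaces-gauge-fixing-p027-x2.png`),
pp. 82–83, 86–88 through the verbatim quotations of `B8Thm4MultiLevelTorus` (own, gen 71, referee-signed) and p. 101 also through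
`B8SectDSource` (b08, referee-signed); [B6] = T. Bałaban, *Propagators and renormalization transformations for lattice gauge theories. II*,
Commun. Math. Phys. **96** (1984) 223–250 [Balaban1984PropagatorsII], Sect. A pp. 224–226 through p21's verbatim quotations in
`B6SectAOperatorsV1` / `B6SectACriticalPointV1` / `B6SectAVectorModelV1`; [4] = *Propagators … I*, Commun. Math. Phys. **95** (1984) 17–40
[Balaban1984PropagatorsI], (1.21) p. 21 (the lattice operators `∂`, `∂*`, `Δ`).

CITATION HEADER (lean-in-tree rule).  Cell `lit-balaban` (HOME `run/shared/lean/pub/lit-balaban/`), unit `lit-balaban-r05` gen 74 (B8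
reader/typer and fold owner; free target under protocol G.5-34(d), TAKING HOME/STATUS.md 2026-08-25T08:02:50Z, courtesy lines to p21 / p38 /
r03).  WHAT IS REPRODUCED = SKELETON rows **B8.Thm8** and **B8.Eq1.146** (MEMBER cells; heads `typed-existing` unchanged), as «kernel-checked
proofs of a model instance» on p21's `k`-level nested torus family `TDomains d ℓ M_h k P′ R` carrying r03's V1 global chart
(`B6GlobalChartV1`: `PV`, `domT`, `blkV1`) and p21's Sect.-A Hilbert-space calculus (`B6SectAOperatorsV1`: `∂ = dE`, `∂* = dsE`, curl `dcE`
and its adjoint `dcsE`, `Δ = lapE = ∂*∂`, the multi-scale averages `Q = QE`, `Q′ = QpE`, the orthogonal projection `R = RE` onto `ΔN(Q′)`;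
`B6SectAVectorModelV1`: the vector operator `Δ_a = deltaAE` of (2.19) and its inverse `G = GE`).  THIS MODULE is the `k`-level companion of
(a) b08's ABSTRACT `B8SectDSource.thm8_sectD_inspected` (Theorem 8 by the Sect.-D contraction with a source, Banach-space letters, with
the ADDED input `|D^η_{U₀}f|₍₋₃₎ < γ(α₀ + α₁)`), and (b) the cell's one-level G-B8-13 files `B8Thm8TorusWitness` / `B8Thm8FlatAbelianFamily` /
`B8Thm8U1Family` (the `∇`- and Hölder members of (1.36) FAIL for sources with only `|f|₍₋₂₎ < γ(α₀ + α₁)`, `k·log L` growth): here, on the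
`k`-level torus at `U₀ = 1`, the whole `f`-dependence of Theorem 8's solution is ONE pure-gauge term `∂g`, `g = Δ⁻¹↾_{N(Q′)}f`, and every
member of (1.36)/(1.37)/(1.39)/(1.146) is tracked exactly.

WHAT IS PRINTED (p. 101 [PDF 27], verbatim).  *"general condition of the form R(U₀)D^{η*}_{U₀}A = f, (1.146) where f is a function from
the space R(U₀), i.e. a Lie algebra valued function defined on Ω₀ and satisfying R(U₀)f = f. Of course we have to assume that f is in a
sufficiently small neighborhood of 0, for example it is enough to assume that |f|₍₋₂₎ < γ(α₀ + α₁) with a positive, not too big, constant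
γ, e.g. γ = 1. Inspecting the proofs of the theorems and propositions we can see easily that they work in this more general situation
almost without any changes, only some constants change their numerical values. Thus we have the following generalization of Theorem 2.
**Theorem 8.** There exist constants B₁, B₂(β₀), c₁ such that for arbitrary U₀, U′U₀ satisfying (1.33)–(1.35) with α₀ + α₁ ≦ c₁, and
for an arbitrary function f from the space R(U₀) satisfying the bound |f|₍₋₂₎ < γ(α₀ + α₁), there exists exactly one gauge transformation
u satisfying (1.29) and such, that the conditions (1.36), (1.37), (1.39), and (1.146) hold for the configuration U₁ = U′^{u⁻¹}. The
constants B₁, B₂(β₀) are as in Theorems 2, 4, the constant c₁ depends on d, L and γ."*  (p. 82 (1.36)–(1.38), p. 83 (1.39), p. 88 Theorem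
4, p. 86 (1.55)–(1.56), p. 87 (1.62): quoted verbatim in `B8Thm4MultiLevelTorus`.)  [B6] p. 225 (through `B6SectACriticalPointV1`): *"let R
be an orthogonal projection in the space L²(T_η) onto the subspace ΔN(Q′) … This minimum satisfies the equation R∂*A^{λ₀} = 0 (2.12)"*;
[B6] (2.19) p. 226 (through `B6SectAVectorModelV1`): `Δ_a = ∂*∂ + ∂R∂* + Q*aQ`.

THE INSTANCE (dictionary print ↦ Lean) = that of `B8Thm4MultiLevelTorus` word for word (`U₀ = 1`; `U′ = e^{iηA′}` IS the real bond field
`A′ : BondSpace (PV …)`; `u = e^{iλ}` IS `λ : ScalarSpace (PV …)`; (1.17) IS `A′ ↦ A′ − ∂λ`; (1.29) IS `λ ∈ N(Q′) = ker (QpE (domT hN D hk))`;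
`R(U₀)` IS `RE (domT hN D hk) c′`; `D^{η*}_{U₀}D^η_{U₀}` on vector fields IS `dcsE c′ ∘ dcE c′`; `Q_j` IS `QE`; `∇^η_{U₀}` IS p38's `DV ν c′`;
`Δ^η_{U₀}` IS the componentwise `LatticeFieldCalculus.laplace c′`; `|·|₍₋γ₎` IS `B8ScaledSupNorm.msup (ℓ+1) k η (−γ)`, `η = |c′|⁻¹`), PLUS:
«a function f from the space R(U₀)» IS `f : ScalarSpace (PV …)` with `RE (domT hN D hk) c′ f = f`; (1.146) IS `RE … (dsE c′ (A′ − dE c′ λ)) = f`;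
«|f|₍₋₂₎ < γ(α₀ + α₁)» and the inspected «|D^η_{U₀}f|₍₋₃₎ < γ(α₀ + α₁)» (b08's reading of «Inspecting the proofs …», `B8SectDSource` §5) ARE
the pointwise forms `|f(x)| ≦ γ(α₀ + α₁)((L^{j(x)})η)⁻²` resp. `|(∂f)(b)| ≦ γ₁(α₀ + α₁)((L^{j(b)})η)⁻³`.

THE MATHEMATICS (print: «Inspecting the proofs … they work in this more general situation almost without any changes»; here is what the
inspection gives AT `U₀ = 1`, kernel-checked).  Let `f ∈ ΔN(Q′)` (= the range of `R`).  There is exactly one `g ∈ N(Q′)` with `Δg = f` (§1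
`potential_existsUnique`; [B6] p. 225 «Δλ₀ = R∂*A … has exactly one solution»), print's `G′f`.  Since `R∂*∂g = RΔg = Δg = f` (`RE_fix`), the
sourced condition `R∂*(A′ − ∂λ) = f` is EQUIVALENT to the Landau condition `R∂*((A′ − ∂g) − ∂λ) = 0` for the shifted datum `A″ := A′ − ∂g`
(§1 `sourced_iff_landau_shift`), and `A″` has the same data as `A′`: `∂*∂A″ = ∂*∂A′` (curl of a gradient vanishes), `QA″ = QA′` (`Q∂g = 0` for
`g ∈ N(Q′)`).  Hence THEOREM 4 (`thm4_multiLevelTorus_V1`) applied to `A″` with the SAME sizes `α₀, α₁` gives the unique restricted `λ`, and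
the solution field is `A := A′ − ∂λ = A_L + ∂g` with `A_L := A″ − ∂λ` Theorem 4's Landau-gauge output.  The source term `∂g` is controlled by
the VECTOR theory: by (2.19), `Δ_a(∂g) = ∂*∂∂g + ∂R∂*∂g + Q*aQ∂g = 0 + ∂f + 0 = ∂f`, so `∂g = G(1)(∂f)` (§1 `dE_potential_eq_GE`), and on the
lattice `Δ(∂g) = ∂(Δg) = ∂f` componentwise (§1 `laplace_dE_component`, unit shifts commute).  Consequently: (1.146), (1.37) `QA = QA′` and the
`D^{η*}D^η`-member of (1.39) hold EXACTLY as in Theorem 4 for EVERY `f` of the space `R` (no size needed — §3 (i)–(iii)); and under the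
inspected size `|(∂f)(b)| ≦ γ₁(α₀ + α₁)((L^{j(b)})η)⁻³` the remaining sup members `|A|₍₋₁₎`, `|∇A|₍₋₂₎`, `|ΔA|₍₋₃₎` hold with «only some
constants change their numerical values»: `B₁ ↦ B₁ + B₈γ₁`, `B₈ = B₀·A + 1` (`B₀` = own `ineq159_multiLevelTorus_V1_three_eta`, `A` = p38's
(2.136)₁,₂ constant of `prop26_2136_grad_kLevel_unconditional_pad_V1` — the genuine `k`-level `G(1)`, hypothesis-free) — §2 `pureGauge_source_bounds`,
§3 (v).  Under PRINT'S OWN size `|f|₍₋₂₎ ≦ γ(α₀ + α₁)` the `|A|`-member survives (and only it, among the sup members — G-B8-13): since `Q′g = 0`,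
`Δ′_ag = (Δ + Q′*aQ′)g = f`, so `g = G′f` with [B6] (2.17)'s `G′ = Δ′_a⁻¹` (§5 `potential_fun_eq_GpV`, through r03's scalar chart of p21's genuine
`k`-level torus matrix), and p. 93's «G′ is a bounded operator from a space with the norm |·|₍₋₂₎ into a space with … the norm |·|₍₋₁₎ for their
first derivatives» holds AT `U₀ = 1` hypothesis-free: r03's charted (2.67) majorant `|(∂G′)(x, y)| ≦ Cη⁻¹L^{j(y)}e^{−δd(j(x),j(y))}`
(`B6ScalarFactorsChartV1.factors_V1`) fed to the [4] (3.47) engine `sup347_eta` gives `|∂G′f|₍₋₁₎ ≦ B′₀|f|₍₋₂₎` (§5 `dE_potential_bound_printed`),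
whence `|A|₍₋₁₎ ≦ (B₁ + B′₀γ)(α₀ + α₁)` (§5 `thm8_multiLevelTorus_V1_surviving`).

WHAT THIS MODULE PROVES (kernel-checked, 0 sorry, no `def`, no `… : Prop` fact — 13 theorems + 1 private; standard axioms; ONE import: own
`B8Thm4MultiLevelTorus`).
§1 (any V1 torus `P`, any nested family `D : Domains P`): `potential_existsUnique` (f = Rf ⇒ ∃! g ∈ N(Q′), Δg = f), `sourced_iff_landau_shift`,
   `deltaAE_dE_of_ker` (`Δ_a(∂g) = ∂(Δg)` for `g ∈ N(Q′)`), `dE_potential_eq_GE` (`∂g = G(1)(∂Δg)`), `laplace_dE_component` (`Δ(∂g) = ∂(Δg)`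
   componentwise), `sub_dE_eq_shift_add` (`A′ − ∂λ = (A″ − ∂λ) + ∂g`).
§2 `pureGauge_source_bounds` — on the `k`-level V1 torus, for `g ∈ N(Q′)` with `|(∂Δg)(b)| ≦ S((L^{j(b)})η)⁻³`: `|(∂g)(b)| ≦ B₈S((L^{j(b)})η)⁻¹`,
   `|(∇_ν∂g)(b)| ≦ B₈S((L^{j(b)})η)⁻²`, `|(Δ∂g)(b)| ≦ S((L^{j(b)})η)⁻³` (the last an identity), ONE threshold, no [B6]-side hypothesis.
§3 **`thm8_multiLevelTorus_V1`** — THEOREM 8 AT `U₀ = 1` ON THE `k`-LEVEL V1 TORUS: for the weight band `0 < b₀ ≤ b₁` there is `σ₀ > 0` such that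
   for all `σ ∈ (0, σ₀]`, `α ∈ (0, 1)` there are constants `B₁ ≥ 1`, `B₈ ≥ 1` and ONE threshold `M₈ > 0` such that on every admissible `k`-level
   V1 torus, for every `α₀, α₁ ≥ 0`, every datum `A′` with the processed (1.34)/(1.66) sizes of Theorem 4 and EVERY `f` with `Rf = f`:
   (i) «exactly one gauge transformation u satisfying (1.29) and … (1.146)» — `∃! λ ∈ N(Q′)`, `R∂*(A′ − ∂λ) = f`; and for it, with `A := A′ − ∂λ`:
   (ii) (1.37) `QA = QA′` and `∂*∂A = ∂*∂A′`; (iii) (1.39) `|(D^{η*}D^ηA)(b)| ≦ B₁(α₀ + α₁)((L^{j(b)})η)⁻³`; (iv) STRUCTURE: for THE potential `g`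
   of `f`, `A − ∂g` obeys every member of Theorem 4 with `B₁(α₀ + α₁)` (it IS Theorem 4's output for `A″`); (v) INSPECTED: if moreover
   `|(∂f)(b)| ≦ γ₁(α₀ + α₁)((L^{j(b)})η)⁻³` (`γ₁ ≥ 0`), then `|A|₍₋₁₎, |∇A|₍₋₂₎, |ΔA|₍₋₃₎ ≦ (B₁ + B₈γ₁)(α₀ + α₁)` and the three pointwise
   «on Ω_j» forms.
§4 **`thm8_multiLevelTorus_V1_inspected`** — the same packaged as Theorem 8's sentence (∃! restricted `u`; (1.146), (1.37), (1.36) sup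
   members, (1.39)) under the inspected source size, as own `thm2_multiLevelTorus_V1`.
§5 (print's OWN source size): `potential_fun_eq_GpV` (`g ∈ N(Q′)`, `Δg = f` ⇒ `g = G′f`, `G′ = GpV` r03's charted inverse of p21's `k`-level
   torus matrix `Δ′_a`), `dE_potential_fun_eq` (`∂g = (∂∘G′)f`), **`dE_potential_bound_printed`** — p. 93 / (1.101)'s `∂G′`-clause AT `U₀ = 1` on
   the `k`-level V1 torus, HYPOTHESIS-FREE: ONE `B′₀ ≥ 1`, ONE threshold; `|f(x)| ≦ S((L^{j(x)})η)⁻²` ⇒ `|(∂g)(b)| ≦ B′₀S((L^{j(b)})η)⁻¹`; and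
   **`thm8_multiLevelTorus_V1_surviving`** — THEOREM 8 AT `U₀ = 1` under «|f|₍₋₂₎ < γ(α₀ + α₁)» ITSELF (pointwise form, `γ ≥ 0`): `∃! λ ∈ N(Q′)` with
   (1.146); (1.37); the `|A|`-member of (1.36) `|A|₍₋₁₎ ≦ (B₁ + B′₀γ)(α₀ + α₁)` and its pointwise form; the `D^{η*}D^η`-member of (1.39) — exactly
   the surviving part of the printed sentence (G-B8-13 / b08's `B8SectGH.Thm8Inspected`).

HONEST SCOPE / NOT CLAIMED.  (i) `U₀ = 1` and the LINEAR chart ONLY (as `B8Thm4MultiLevelTorus`): rows B8.Thm8 / B8.Eq1.146 keep their heads;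
the printed generality (arbitrary regular `U₀`, Sects. C–E with [4] Thms 3.1–3.3) is r06's interface I-B8-2.  (ii) THE SOURCE SIZE: print
assumes `|f|₍₋₂₎ < γ(α₀ + α₁)` only.  Under that hypothesis alone this module proves (i)–(iv) of §3 (which need NO size) but NOT the sup members:
at `U₀ = 1` the `|A|`-member DOES follow from `|f|₍₋₂₎` (print p. 93: «G′ is a bounded operator from a space with the norm |·|₍₋₂₎ into a space
with the norm |·| for functions, and the norm |·|₍₋₁₎ for their first derivatives», i.e. `|∂G′f|₍₋₁₎ ≦ B′₀|f|₍₋₂₎` — in the tree on p21's MATRIX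
torus carriers `B8Ineq198MultiLevelTorusP22.ineq1101_multiLevelTorus_two_P22`; HERE, on the V1 carriers, §5 `dE_potential_bound_printed` through
r03's `B6ScalarFactorsChartV1.factors_V1`, hypothesis-free — so §5 `thm8_multiLevelTorus_V1_surviving` gives ∃!, (1.146), (1.37), the `|A|`-member
and the `D^{η*}D^η`-member under print's hypothesis alone), whereas the `∇`- and Hölder members of (1.36) do NOT hold
`k`-uniformly from `|f|₍₋₂₎` alone (GAPS.md G-B8-13, owner adjudication + kernel witnesses `B8HessianSupWitness.scales_lower_bound`,
`B8Thm8FlatAbelianFamily.not_thm8PrintedAt`, `B8Thm8U1Family.not_thm8PrintedAt_angle`): by §3 (iv) they are EXACTLY the second differences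
`∇_ν∂_μG′f` of the potential, the object those witnesses blow up.  The inspected hypothesis `|∂f|₍₋₃₎ ≦ γ₁(α₀ + α₁)` is b08's reading of print's
«Inspecting the proofs» (`B8SectDSource.thm8_sectD_inspected`'s `|D^η_{U₀}f|₍₋₃₎ < γ(α₀ + α₁)`), under which ALL sup members survive (§3 (v)).
(iii) The Hölder member `‖A‖_{1,β}` of (1.36) is not part of the instance (as in `B8Thm4MultiLevelTorus`; the Landau part `A − ∂g` has it by own
`B8Prop3MultiLevelTorusHolder.thm4_holder_member_V1_free`, the source part `∂g = G(1)∂f` would need p22's (2.137)₁ fed with `∂f` — not written).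
(iv) CONSTANTS: print «The constants B₁, B₂(β₀) are as in Theorems 2, 4»; here the sup members carry `B₁ + B₈γ₁` (`B₁ = 5dL·B₀′` of
`thm4_multiLevelTorus_V1`, `B₈ = B₀A + 1`) — for a FIXED `γ` («e.g. γ = 1») a change of the numerical value of `B₁` only, which is what the
sentence before the theorem says («only some constants change their numerical values»); «≦» for «<»; no threshold `c₁` is needed at `U₀ = 1`
in the linear chart (none is assumed).  (v) Real scalar fibre (abelian model); non-abelian groups are not modelled.  (vi) Value = Theorem 8's
sentence kernel-checked in the base case on print's multi-level carrier, with the exact bookkeeping of which member needs which size of the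
source; NOT summit progress; nothing here bears on the Yang–Mills mass gap.

RELATED IN THE TREE, NOT DUPLICATED (stem check 2026-08-25T08:02Z: `ls Balaban1983to89 | grep -i 'thm8\|Eq1146'` = `B8Thm8CrossTerm` (b08),
`B8Thm8FlatAbelianFamily`, `B8Thm8TorusWitness`, `B8Thm8U1Family` (own gen 17: ONE-level refutation/model files); `B8SectDSource` §5 /
`B8SectGH.Thm8PrintedR` (abstract); none states Theorem 8 on the `k`-level torus).  USED BY NAME, nothing re-declared: own
`B8Thm4MultiLevelTorus.{thm4_multiLevelTorus_V1, data_of_restricted}`, own `B8Prop3MultiLevelTorusEta.{ineq159_multiLevelTorus_V1_three_eta,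
pref_eq, msup_le_of_pointwise_blk_eta}`, p38's `B6Prop26GradKLevelV1.prop26_2136_grad_kLevel_unconditional_pad_V1` and `B6GradLegKLevelV1.DV`,
p21's `B6SectAOperatorsV1.{dE, dsE, dcE, dcsE, lapE, QE, QpE, RE, RE_fix, RE_range, mem_ker_QpE_iff, ofLp_lapE}`, `B6SectACriticalPointV1.
{dcE_comp_dE, QE_dE_eq_zero}`, `B6SectAVectorModelV1.{deltaAE, GE, deltaAE_def, GE_deltaAE}`, `B6SectAZeroModesV1.laplace_injOn_gaugeSpace`,
r03's `B6GlobalChartV1.{PV, domT, blkV1, toBox, boxEquiv}`, `B6CubeWindowV1.GlobalBand`, `B6ScalarFactorsChartV1.{GpV, DpV, GpV_mul_DpV, blkS,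
blkV1_eq_blkS, chartOp_apply, factors_V1}`, `B6ScalarChartV1.{lapE_chart, mlOpT_mulVec_of_QB_eq_zero, chart_mem_ker_QpE_iff, boxEquiv_symm_toBox}`,
own `B8Prop3MultiLevelTorusEta.sup347_eta`, p21's `B6MultiLevelTorusOperator.TDomains`, `B6MultiLevelBoxOperator.{N0, aPrinted}`,
`B6Ineq268MultiLevelBox.QB`, `B6Ineq288MultiLevelTorus.dP`, `B4Reflection242.boxDom`, `B6Geom246MultiLevelTorus.geomT`, `B6RandomWalk.{HasMajorant, hasMajorant_mono, hasMajorant_zero, delta3, delta3_pos}`, `B6Ineq2133TwoScaleV1.onFun`, b04's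
`B5Local114G0Second.{shift_shift_comm, unshift_shift_comm}`, `B8ScaledSupNorm.msup`.
-/

open scoped BigOperators

namespace Literature.MathematicalPhysics.QuantumFieldTheory.Balaban1983to89.B8Thm8MultiLevelTorus

open B6MultiLevelBoxOperator (N0)
open B6MultiLevelTorusOperator (TDomains)
open B6Geom246MultiLevelTorus (geomT)
open B6GlobalChartV1 (PV domT blkV1)
open B8Ineq192MultiLevelTorus (lenT_pos)
open B6SectADomainsV1 (Domains)
open B6SectAOperatorsV1 (dE dsE dcE dcsE lapE QE QpE RE ScalarSpace BondIdx RE_fix RE_range mem_ker_QpE_iff ofLp_lapE)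
open B6SectACriticalPointV1 (dcE_comp_dE QE_dE_eq_zero)
open B6SectAVectorModelV1 (deltaAE GE deltaAE_def GE_deltaAE)
open B6SectAZeroModesV1 (laplace_injOn_gaugeSpace)
open B6CubeWindowV1 (GlobalBand)
open B6GradLegKLevelV1 (DV)
open B6RandomWalk (HasMajorant hasMajorant_mono hasMajorant_zero delta3 delta3_pos)
open B6Ineq2133TwoScaleV1 (onFun)
open B6Prop26KLevelSkeletonV1 (pref)
open B6Prop26GradKLevelV1 (prop26_2136_grad_kLevel_unconditional_pad_V1)
open B5Local114G0Second (shift_shift_comm unshift_shift_comm)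
open BalabanImbrieJaffe1984to88.BIJ85AxialPropagator411 (BondSpace)
open B8ScaledSupNorm (msup)
open LatticeFieldCalculus (laplace grad)
open B8Thm4MultiLevelTorus (thm4_multiLevelTorus_V1 data_of_restricted)
open B8Prop3MultiLevelTorusEta (ineq159_multiLevelTorus_V1_three_eta pref_eq msup_le_of_pointwise_blk_eta)
open B8Prop3MultiLevelTorusEta (sup347_eta)
open B4Reflection242 (boxDom)
open B6MultiLevelBoxOperator (aPrinted)
open B6Ineq268MultiLevelBox (QB)
open B6GlobalChartV1 (toBox boxEquiv)
open B6ScalarChartV1 (lapE_chart mlOpT_mulVec_of_QB_eq_zero chart_mem_ker_QpE_iff boxEquiv_symm_toBox)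
open B6ScalarFactorsChartV1 (chartOp_apply GpV DpV GpV_mul_DpV blkS blkV1_eq_blkS factors_V1)
open B6Ineq288MultiLevelTorus (dP)

noncomputable section

/-! ## §1 The algebra of the source at `U₀ = 1` (any nested family on any V1 torus) -/

section Algebra

variable {P : Params} (D : Domains P)

/-- **THE POTENTIAL OF A SOURCE** («f is a function from the space R(U₀) … satisfying R(U₀)f = f», p. 101; [B6] p. 225 «R [is] an
orthogonal projection … onto the subspace ΔN(Q′)», «Δλ₀ = R∂*A, and this equation has exactly one solution»): at `U₀ = 1`, a function `f`
of the space `R` has EXACTLY ONE potential `g ∈ N(Q′)` with `Δg = f` (print's `G′f`; existence: `Rf ∈ ΔN(Q′)`, uniqueness: `Δ` is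
injective on `N(Q′)`, `B6SectAZeroModesV1.laplace_injOn_gaugeSpace`). [cite: Balaban1985RegularSpaces, (1.146) p.101; Balaban1984PropagatorsII, (2.9)–(2.12) p.225] -/
theorem potential_existsUnique {c : ℝ} (hc : c ≠ 0) {f : ScalarSpace P} (hf : RE D c f = f) :
    ∃! g : ScalarSpace P, g ∈ LinearMap.ker (QpE D) ∧ lapE c g = f := by
  obtain ⟨n₀, hn₀, h₀⟩ := RE_range D c f
  refine ⟨n₀, ⟨hn₀, ?_⟩, fun n hn => ?_⟩
  · rw [hf] at h₀
    exact h₀.symm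
  · obtain ⟨hn, h⟩ := hn
    have h0' : lapE c n₀ = f := by
      rw [hf] at h₀
      exact h₀.symm
    have hl : laplace c (WithLp.ofLp n) = laplace c (WithLp.ofLp n₀) := by
      rw [← ofLp_lapE, ← ofLp_lapE, h, h0']
    exact WithLp.ofLp_injective 2
      (laplace_injOn_gaugeSpace D hc ((mem_ker_QpE_iff D n).mp hn) ((mem_ker_QpE_iff D n₀).mp hn₀) hl)

/-- **THE SOURCED CONDITION IS A SHIFTED LANDAU CONDITION**: for the potential `g ∈ N(Q′)` of `f` (`Δg = f`), since `R∂*∂g = RΔg = Δg = f`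
(p21's `RE_fix`), for every `λ`: `R∂*(A′ − ∂λ) = f ⟺ R∂*((A′ − ∂g) − ∂λ) = 0` — (1.146) for the datum `A′` IS (1.38) for the datum `A″ = A′ − ∂g`
(«Inspecting the proofs of the theorems … they work in this more general situation almost without any changes», p. 101).
[cite: Balaban1985RegularSpaces, (1.146) p.101, (1.38) p.82; Balaban1984PropagatorsII, (2.10)–(2.12) p.225] -/
theorem sourced_iff_landau_shift (c : ℝ) {f g : ScalarSpace P} (hg : g ∈ LinearMap.ker (QpE D)) (hgf : lapE c g = f)
    (A' : BondSpace P) (n : ScalarSpace P) :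
    RE D c (dsE c (A' - dE c n)) = f ↔ RE D c (dsE c ((A' - dE c g) - dE c n)) = 0 := by
  have hRg : RE D c (dsE c (dE c g)) = f := by
    rw [RE_fix D c g hg]
    exact hgf
  have hre : (A' - dE c g) - dE c n = (A' - dE c n) - dE c g := sub_right_comm _ _ _
  rw [hre, map_sub (dsE c) (A' - dE c n) (dE c g), map_sub (RE D c) (dsE c (A' - dE c n)) (dsE c (dE c g)), hRg,
    sub_eq_zero]

/-- **`Δ_a(∂g) = ∂(Δg)` FOR A RESTRICTED POTENTIAL** ([B6] (2.19) `Δ_a = ∂*∂ + ∂R∂* + Q*aQ` applied to a pure gauge `∂g`, `g ∈ N(Q′)`: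
`∂*∂∂g = 0` (p21's `dcE_comp_dE`), `R∂*∂g = Δg` (`RE_fix`), `Q∂g = 0` (`QE_dE_eq_zero`)). [cite: Balaban1984PropagatorsII, (2.19) p.226, (2.5)–(2.7) p.224, (2.29)–(2.30) p.227] -/
theorem deltaAE_dE_of_ker (c : ℝ) (w : BondIdx D → ℝ) {g : ScalarSpace P} (hg : g ∈ LinearMap.ker (QpE D)) :
    deltaAE D c w (dE c g) = dE c (lapE c g) := by
  have h1 : dcE c (dE c g) = 0 := by
    have h := LinearMap.congr_fun (dcE_comp_dE (P := P) c) g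
    simpa only [LinearMap.comp_apply, LinearMap.zero_apply] using h
  have h2 : QE D (dE c g) = 0 := QE_dE_eq_zero D c g hg
  rw [deltaAE_def]
  simp only [LinearMap.add_apply, LinearMap.comp_apply, h1, h2, map_zero, zero_add, add_zero, RE_fix D c g hg]
  rfl

/-- **THE SOURCE TERM IS `G(1)∂f`**: for `g ∈ N(Q′)`, `∂g = G(Δ_a∂g) = G(∂Δg)` with p21's `G = Δ_a⁻¹` (`GE_deltaAE`) — the pure-gauge part of
Theorem 8's solution is the vector propagator of (2.22) applied to `∂f`, `f = Δg`. [cite: Balaban1985RegularSpaces, (1.57) p.86, (1.146) p.101; Balaban1984PropagatorsII, (2.19) + (2.22) p.226] -/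
theorem dE_potential_eq_GE {c : ℝ} (hc : c ≠ 0) {w : BondIdx D → ℝ} (hw : ∀ i, 0 < w i) {g : ScalarSpace P}
    (hg : g ∈ LinearMap.ker (QpE D)) :
    dE c g = GE D hc hw (dE c (lapE c g)) := by
  rw [← deltaAE_dE_of_ker D c w hg, GE_deltaAE]

/-- **ON THE LATTICE `Δ∂ = ∂Δ`, COMPONENTWISE**: the componentwise lattice Laplacian ([4] (1.21), factor `c`) of the `μ`-component of `∂g` is
the `μ`-component of `∂(Δg)` (unit shifts commute; the algebra of p22's `B6LapCommutesGradV1.Lap_comp_dE`, here for print's componentwise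
`Δ^η_{U₀}` at `U₀ = 1` as typed in `B8Thm4MultiLevelTorus`). [cite: Balaban1984PropagatorsI, (1.21) p.21; Balaban1985RegularSpaces, (1.39) p.83] -/
theorem laplace_dE_component (c : ℝ) (g : ScalarSpace P) (x : Site P 0) (μ : Fin P.d) :
    laplace c (fun z : Site P 0 => dE c g ⟨z, μ⟩) x = dE c (lapE c g) ⟨x, μ⟩ := by
  simp only [B6SectAOperatorsV1.dE_apply, ofLp_lapE, grad, PBond.tgt, laplace, smul_eq_mul]
  conv_rhs => rw [mul_sub, Finset.mul_sum, Finset.mul_sum, ← Finset.sum_sub_distrib]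
  refine Finset.sum_congr rfl fun ν _ => ?_
  rw [shift_shift_comm x ν μ, ← unshift_shift_comm x ν μ]
  ring

/-- bookkeeping: `A′ − ∂λ = ((A′ − ∂g) − ∂λ) + ∂g` — Theorem 8's field is Theorem 4's Landau output for the shifted datum PLUS the source term.
[cite: Balaban1985RegularSpaces, (1.146) p.101 («almost without any changes»)] -/
theorem sub_dE_eq_shift_add (c : ℝ) (A' : BondSpace P) (g n : ScalarSpace P) :
    A' - dE c n = ((A' - dE c g) - dE c n) + dE c g := by abel

/-- the componentwise lattice Laplacian is additive. [cite: Balaban1984PropagatorsI, (1.21) p.21] -/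
private theorem laplace_add' (c : ℝ) (u v : Site P 0 → ℝ) (x : Site P 0) :
    laplace c (fun z => u z + v z) x = laplace c u x + laplace c v x := by
  simp only [laplace, smul_eq_mul, ← Finset.sum_add_distrib]
  refine Finset.sum_congr rfl fun ν _ => ?_
  ring

end Algebra

/-! ## §2 The source term `∂g = G(1)∂f` on the `k`-level V1 torus: bounds, no [B6]-side hypothesis -/

open Classical in
/-- **THE PURE-GAUGE SOURCE TERM IS SMALL** («only some constants change their numerical values», p. 101): for the weight band `0 < b₀ ≤ b₁`
there is `σ₁ > 0` such that for all `σ ∈ (0, σ₁]`, `α ∈ (0, 1)` there are ONE constant `B₈ ≥ 1` and ONE threshold `M₈ > 0` such that on every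
admissible `k`-level V1 torus (`k ≥ 1`, `M_h = Lᵃ ≥ 8`, `R ≥ 2L²`, `P′ ≥ 5L`, `L ≥ 5` odd, `M₈ ≤ L·M_h`; `c′ ≠ 0`, weights in the band), for every
restricted potential `g ∈ N(Q′)` with `|(∂Δg)(b)| ≦ S((L^{j(b)})η)⁻³`: `|(∂g)(b)| ≦ B₈S((L^{j(b)})η)⁻¹`, `|(∇_ν∂g)(b)| ≦ B₈S((L^{j(b)})η)⁻²`
(every `ν`) and `|(Δ∂g)_μ(x)| = |(∂Δg)(⟨x, μ⟩)| ≦ S((L^{j})η)⁻³` — because `∂g = G(1)(∂Δg)` (§1) and the genuine `k`-level `G(1)`, `∇_νG(1)` carry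
p38's hypothesis-free (2.136)₁,₂ majorants (`prop26_2136_grad_kLevel_unconditional_pad_V1`), fed to own (1.59) engine
`ineq159_multiLevelTorus_V1_three_eta` ([4] (3.47)); `B₈ = B₀·A + 1`. [cite: Balaban1985RegularSpaces, (1.59) p.86, (1.101) p.93, Thm 8 p.101; Balaban1984PropagatorsII, Prop. 2.6 (2.136) p.247, (2.19) + (2.22) p.226; Balaban1985BackgroundPropagators, (3.47) p.398] -/
theorem pureGauge_source_bounds (d ℓ : ℕ) (hd : 1 ≤ d + 1) (hL : Odd (ℓ + 1) ∧ 1 < ℓ + 1) {b₀ b₁ : ℝ} (hb₀ : 0 < b₀)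
    (hb₁ : b₀ ≤ b₁) :
    ∃ σ₁ : ℝ, 0 < σ₁ ∧ ∀ (σ : ℝ), 0 < σ → σ ≤ σ₁ → ∀ (α : ℝ), 0 < α → α < 1 →
    ∃ B₈ M₈ : ℝ, 1 ≤ B₈ ∧ 0 < M₈ ∧
    ∀ (m K : ℕ) {Mh k R : ℕ} {P' : Fin (d + 1) → ℕ}
      (hN : ∀ μ, N0 ℓ Mh k P' μ = (PV d ℓ m K hd hL).sitesPerDir 0) (D : TDomains d ℓ Mh k P' R) (hk : k ≤ m + K) (_ : 1 ≤ k)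
      {a : ℕ} (_ : Mh = (ℓ + 1) ^ a) (_ : 8 ≤ Mh) (_ : 2 * (ℓ + 1) ^ 2 ≤ R) (_ : ∀ μ, 5 * (ℓ + 1) ≤ P' μ) (_ : 4 ≤ ℓ)
      (_ : M₈ ≤ ((ℓ : ℝ) + 1) * Mh)
      {cf : ℝ} (hcf : cf ≠ 0) {w : BondIdx (domT hN D hk) → ℝ} (_ : ∀ i, 0 < w i) (_ : GlobalBand b₀ b₁ cf w),
      ∀ (g : ScalarSpace (PV d ℓ m K hd hL)), g ∈ LinearMap.ker (QpE (domT hN D hk)) →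
      ∀ (S : ℝ), 0 ≤ S →
        (∀ b, |dE cf (lapE cf g) b| ≤ S * (((geomT D).len (blkV1 hN D b) * |cf|⁻¹) ^ 3)⁻¹) →
        ∀ b : PBond (PV d ℓ m K hd hL) 0,
          |WithLp.ofLp (dE cf g) b| ≤ B₈ * S * (((geomT D).len (blkV1 hN D b) * |cf|⁻¹) ^ 1)⁻¹ ∧
          (∀ ν : Fin (d + 1), |DV (P := PV d ℓ m K hd hL) ν cf (WithLp.ofLp (dE cf g)) b| ≤
              B₈ * S * (((geomT D).len (blkV1 hN D b) * |cf|⁻¹) ^ 2)⁻¹) ∧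
          |laplace cf (fun z => (dE cf g) ⟨z, b.dir⟩) b.src| ≤ S * (((geomT D).len (blkV1 hN D b) * |cf|⁻¹) ^ 3)⁻¹ := by
  -- p38's admissible range of rates for the band, and the (2.136)₁,₂ majorants of the genuine `G(1)`, `∇G(1)` (hypothesis-free)
  obtain ⟨σ₁, hσ₁, h26⟩ := prop26_2136_grad_kLevel_unconditional_pad_V1 d ℓ hd hL hb₀ hb₁
  refine ⟨σ₁, hσ₁, fun σ hσ hσle α hα0 hα1 => ?_⟩
  -- the (1.59) engine of this lineage at the delivered rate `δ₃ = delta3 α (2σ)`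
  have hσ' : 0 < delta3 α (2 * σ) := delta3_pos hα1 (by positivity)
  obtain ⟨B₀, N₁, hB₀, hN₁, h159⟩ := ineq159_multiLevelTorus_V1_three_eta d ℓ hσ'
  obtain ⟨Amaj, M₂, hA, hM₂, hG26⟩ := h26 σ hσ hσle α hα0 hα1.le
  -- ONE constant `B₈ = B₀·A + 1 ≥ 1`, ONE threshold `M₈ = max M₂ (N₁ + 1)`
  refine ⟨B₀ * Amaj + 1, max M₂ ((N₁ : ℝ) + 1), le_add_of_nonneg_left (mul_nonneg (by linarith) hA),
    lt_max_of_lt_left hM₂, ?_⟩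
  intro m K Mh k R P' hN D hk hk1 a hMha hM8 hR2 hP hℓ4 hM8t cf hcf w hw hwb g hg S hS hX b
  -- thresholds
  have hM2t : M₂ ≤ ((ℓ : ℝ) + 1) * Mh := le_trans (le_max_left _ _) hM8t
  have hN1r : (N₁ : ℝ) + 1 ≤ ((ℓ : ℝ) + 1) * Mh := le_trans (le_max_right _ _) hM8t
  have hMh1 : 1 ≤ Mh := le_trans (by norm_num) hM8
  have hN1t : N₁ + 1 ≤ R * ((ℓ + 1) * Mh) := by
    have h1 : N₁ + 1 ≤ (ℓ + 1) * Mh := by exact_mod_cast hN1r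
    have hR1 : 1 ≤ R := le_trans (Nat.one_le_iff_ne_zero.mpr (by positivity)) hR2
    calc N₁ + 1 ≤ (ℓ + 1) * Mh := h1
      _ = 1 * ((ℓ + 1) * Mh) := (one_mul _).symm
      _ ≤ R * ((ℓ + 1) * Mh) := Nat.mul_le_mul_right _ hR1
  have hP1 : ∀ μ, 1 ≤ P' μ := fun μ => le_trans (by omega) (hP μ)
  have hη : 0 < |cf|⁻¹ := inv_pos.2 (abs_pos.2 hcf)
  -- the two majorants for the genuine `G(1)` of `D`, in the engine's prefactor shapes
  obtain ⟨hG, hD⟩ := hG26 m K hN D hk hk1 hMha hM8 hR2 hP hℓ4 hM2t hcf hw hwb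
  have hG' : HasMajorant (g := geomT D) (blkV1 hN D) (onFun (GE (domT hN D hk) hcf hw))
      (fun y y' => Amaj * ((geomT D).len y * |cf|⁻¹) ^ 2 * Real.exp (-(delta3 α (2 * σ) * (geomT D).dist y y'))) :=
    hasMajorant_mono (g := geomT D) (blkV1 hN D) hG fun y y' => le_of_eq (by rw [pref_eq])
  have hL' : HasMajorant (g := geomT D) (blkV1 hN D) (0 : Module.End ℝ (PBond (PV d ℓ m K hd hL) 0 → ℝ))
      (fun y y' => Amaj * Real.exp (-(delta3 α (2 * σ) * (geomT D).dist y y'))) :=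
    hasMajorant_mono (g := geomT D) (blkV1 hN D) (hasMajorant_zero (g := geomT D) (blkV1 hN D))
      fun y y' => mul_nonneg hA (Real.exp_nonneg _)
  -- the engine applied to `X := ∂Δg`
  have key := h159 k Mh R hMh1 hN1t P' hP1 D m K hd hL hN |cf|⁻¹ hη Amaj hA
    (onFun (GE (domT hN D hk) hcf hw)) 0 (fun ν => DV (P := PV d ℓ m K hd hL) ν cf ∘ₗ onFun (GE (domT hN D hk) hcf hw))
    hG' hD hL' (WithLp.ofLp (dE cf (lapE cf g))) S hS hX b
  obtain ⟨k1, k2, -⟩ := key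
  -- `∂g = G(1)(∂Δg)` read on functions
  have hrepr : onFun (GE (domT hN D hk) hcf hw) (WithLp.ofLp (dE cf (lapE cf g))) = WithLp.ofLp (dE cf g) := by
    funext b'
    rw [B6Ineq2133TwoScaleV1.onFun_apply, WithLp.toLp_ofLp]
    exact congrArg (fun v : BondSpace (PV d ℓ m K hd hL) => WithLp.ofLp v b')
      (dE_potential_eq_GE (domT hN D hk) hcf hw hg).symm
  have hw1 : 0 ≤ (((geomT D).len (blkV1 hN D b) * |cf|⁻¹) ^ 1)⁻¹ :=
    inv_nonneg.2 (pow_nonneg (mul_nonneg (lenT_pos D _).le hη.le) 1)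
  have hw2 : 0 ≤ (((geomT D).len (blkV1 hN D b) * |cf|⁻¹) ^ 2)⁻¹ :=
    inv_nonneg.2 (pow_nonneg (mul_nonneg (lenT_pos D _).le hη.le) 2)
  have hBA : B₀ * Amaj * S ≤ (B₀ * Amaj + 1) * S := mul_le_mul_of_nonneg_right (by linarith) hS
  refine ⟨?_, fun ν => ?_, ?_⟩
  · -- `|∂g(b)| ≦ B₀·A·S·((Lʲ)η)⁻¹`
    rw [← hrepr]
    calc |onFun (GE (domT hN D hk) hcf hw) (WithLp.ofLp (dE cf (lapE cf g))) b|
        ≤ B₀ * Amaj * S * ((geomT D).len (blkV1 hN D b) * |cf|⁻¹)⁻¹ := k1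
      _ = B₀ * Amaj * S * (((geomT D).len (blkV1 hN D b) * |cf|⁻¹) ^ 1)⁻¹ := by rw [pow_one]
      _ ≤ (B₀ * Amaj + 1) * S * (((geomT D).len (blkV1 hN D b) * |cf|⁻¹) ^ 1)⁻¹ := mul_le_mul_of_nonneg_right hBA hw1
  · -- `|∇_ν∂g(b)| ≦ B₀·A·S·((Lʲ)η)⁻²`
    have h2 := k2 ν
    simp only [LinearMap.comp_apply, hrepr] at h2
    exact h2.trans (mul_le_mul_of_nonneg_right hBA hw2)
  · -- `Δ(∂g) = ∂(Δg)` componentwise, then the hypothesis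
    rw [laplace_dE_component]
    exact hX ⟨b.src, b.dir⟩

/-! ## §3 Theorem 8 at `U₀ = 1` on the `k`-level V1 torus -/

open Classical in
/-- **THEOREM 8 AT THE FLAT BACKGROUND `U₀ = 1` ON THE `k`-LEVEL V1 TORUS** (p. 101, verbatim: *"There exist constants B₁, B₂(β₀), c₁ such
that for arbitrary U₀, U′U₀ satisfying (1.33)–(1.35) with α₀ + α₁ ≦ c₁, and for an arbitrary function f from the space R(U₀) satisfying the
bound |f|₍₋₂₎ < γ(α₀ + α₁), there exists exactly one gauge transformation u satisfying (1.29) and such, that the conditions (1.36), (1.37),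
(1.39), and (1.146) hold for the configuration U₁ = U′^{u⁻¹}. The constants B₁, B₂(β₀) are as in Theorems 2, 4, the constant c₁ depends on
d, L and γ."*) — typed reading in the linear chart (THE INSTANCE): for the weight band `0 < b₀ ≤ b₁` there is `σ₀ > 0` such that for all
`σ ∈ (0, σ₀]`, `α ∈ (0, 1)` there are constants `B₁ ≥ 1` («as in Theorems 2, 4»: `thm4_multiLevelTorus_V1`'s `5dL·B₀′`), `B₈ ≥ 1` and ONE
threshold `M₈ > 0` such that on every admissible `k`-level V1 torus, for every `α₀, α₁ ≥ 0`, every datum `A′` with the processed (1.34)/(1.66)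
sizes `|(∂*∂A′)(b)| ≦ 2α₀(L^{j(b)}η)⁻³`, `|(Q_jA′)(c)| ≦ 2dLα₁(Lʲη)⁻¹` on `Λ_j`, and EVERY «function f from the space R(U₀)» (`Rf = f`):
(i) «exactly one gauge transformation u satisfying (1.29) and … (1.146)» — `∃! λ ∈ N(Q′)` with `R∂*(A′ − ∂λ) = f`; (ii) for it (indeed for
every restricted `λ` with (1.146)), `A := A′ − ∂λ` satisfies (1.37) `QA = QA′`, `∂*∂A = ∂*∂A′`, and (iii) the (1.39) member
`|(D^{η*}D^ηA)(b)| ≦ B₁(α₀ + α₁)(L^{j(b)}η)⁻³`; (iv) STRUCTURE — for THE potential `g ∈ N(Q′)`, `Δg = f` (§1), `A − ∂g` IS Theorem 4's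
Landau-gauge output for the datum `A′ − ∂g` and obeys ALL its members with `B₁(α₀ + α₁)`: `|·|₍₋₁₎`, `|∇·|₍₋₂₎`, `|Δ·|₍₋₃₎` pointwise «on Ω_j»;
(v) INSPECTED SIZE («Inspecting the proofs …»; b08's `|D^η_{U₀}f|₍₋₃₎ < γ(α₀ + α₁)`): if `|(∂f)(b)| ≦ γ₁(α₀ + α₁)(L^{j(b)}η)⁻³`, `γ₁ ≥ 0`, then
the sup members of (1.36)/(1.39) hold for `A` itself with «only some constants change[d]»: `|A|₍₋₁₎, |∇A|₍₋₂₎, |ΔA|₍₋₃₎ ≦ (B₁ + B₈γ₁)(α₀ + α₁)`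
and the three pointwise «on Ω_j» forms.  No threshold `c₁`, no [B6]-side hypothesis. [cite: Balaban1985RegularSpaces, Thm 8 + (1.146) p.101, Thm 4 p.88, Thm 2 p.83, (1.29) p.81, (1.36)–(1.38) p.82, (1.39) p.83, (1.62) + Prop. 3 p.87, (1.55)–(1.59) p.86, (1.66) p.87; Balaban1984PropagatorsII, (2.7) p.224, (2.12) p.225, (2.19) + (2.22) p.226, Prop. 2.6 (2.136) p.247] -/
theorem thm8_multiLevelTorus_V1 (d ℓ : ℕ) (hd : 1 ≤ d + 1) (hL : Odd (ℓ + 1) ∧ 1 < ℓ + 1) {b₀ b₁ : ℝ} (hb₀ : 0 < b₀) (hb₁ : b₀ ≤ b₁) :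
    ∃ σ₀ : ℝ, 0 < σ₀ ∧ ∀ (σ : ℝ), 0 < σ → σ ≤ σ₀ → ∀ (α : ℝ), 0 < α → α < 1 →
    ∃ B₁ B₈ M₈ : ℝ, 1 ≤ B₁ ∧ 1 ≤ B₈ ∧ 0 < M₈ ∧
    ∀ (m K : ℕ) {Mh k R : ℕ} {P' : Fin (d + 1) → ℕ}
      (hN : ∀ μ, N0 ℓ Mh k P' μ = (PV d ℓ m K hd hL).sitesPerDir 0) (D : TDomains d ℓ Mh k P' R) (hk : k ≤ m + K) (_ : 1 ≤ k)
      {a : ℕ} (_ : Mh = (ℓ + 1) ^ a) (_ : 8 ≤ Mh) (_ : 2 * (ℓ + 1) ^ 2 ≤ R) (_ : ∀ μ, 5 * (ℓ + 1) ≤ P' μ) (_ : 4 ≤ ℓ)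
      (_ : M₈ ≤ ((ℓ : ℝ) + 1) * Mh)
      {cf : ℝ} (hcf : cf ≠ 0) {w : BondIdx (domT hN D hk) → ℝ} (_ : ∀ i, 0 < w i) (_ : GlobalBand b₀ b₁ cf w),
      ∀ (A' : BondSpace (PV d ℓ m K hd hL)) (f : ScalarSpace (PV d ℓ m K hd hL)),
        -- «f is a function from the space R(U₀) … satisfying R(U₀)f = f»
        RE (domT hN D hk) cf f = f →
        ∀ (α₀ α₁ : ℝ), 0 ≤ α₀ → 0 ≤ α₁ →
        -- (1.34) processed through (1.55) at `U₀ = 1`: `|D*DA′|₍₋₃₎ ≦ 2α₀`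
        (∀ b, |dcsE cf (dcE cf A') b| ≤ 2 * α₀ * (((geomT D).len (blkV1 hN D b) * |cf|⁻¹) ^ 3)⁻¹) →
        -- (1.66)/(1.35) processed through (1.37)/(1.56): `|Q_jA′| ≦ 2dLα₁(Lʲη)⁻¹` on `Λ_j`
        (∀ i, |QE (domT hN D hk) A' i| ≤ 2 * ((d : ℝ) + 1) * ((ℓ : ℝ) + 1) * α₁ * (((ℓ : ℝ) + 1) ^ (i.1.1 : ℕ) * |cf|⁻¹)⁻¹) →
        -- (i) «there exists exactly one gauge transformation u satisfying (1.29) and such that … (1.146)»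
        (∃! n : ScalarSpace (PV d ℓ m K hd hL),
            n ∈ LinearMap.ker (QpE (domT hN D hk)) ∧ RE (domT hN D hk) cf (dsE cf (A' - dE cf n)) = f) ∧
        ∀ n : ScalarSpace (PV d ℓ m K hd hL), n ∈ LinearMap.ker (QpE (domT hN D hk)) →
          RE (domT hN D hk) cf (dsE cf (A' - dE cf n)) = f →
          -- (ii) (1.37) «basically of an algebraic character»: `QA = QA′`, and `D*DA = D*DA′`
          QE (domT hN D hk) (A' - dE cf n) = QE (domT hN D hk) A' ∧
          dcsE cf (dcE cf (A' - dE cf n)) = dcsE cf (dcE cf A') ∧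
          -- (iii) (1.39): `|D^{η*}_{U₀}D^η_{U₀}A| ≦ B₁(α₀ + α₁)(Lʲη)⁻³ on Ω_j` — EXACTLY as in Theorem 4
          (∀ b : PBond (PV d ℓ m K hd hL) 0,
              |dcsE cf (dcE cf (A' - dE cf n)) b| ≤ B₁ * (α₀ + α₁) * (((geomT D).len (blkV1 hN D b) * |cf|⁻¹) ^ 3)⁻¹) ∧
          -- (iv) STRUCTURE: `A − ∂g`, `g` THE potential of `f`, is Theorem 4's Landau output for `A′ − ∂g` with all its members
          (∃ g : ScalarSpace (PV d ℓ m K hd hL), g ∈ LinearMap.ker (QpE (domT hN D hk)) ∧ lapE cf g = f ∧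
            RE (domT hN D hk) cf (dsE cf ((A' - dE cf g) - dE cf n)) = 0 ∧
            A' - dE cf n = ((A' - dE cf g) - dE cf n) + dE cf g ∧
            (∀ b : PBond (PV d ℓ m K hd hL) 0,
              |WithLp.ofLp ((A' - dE cf g) - dE cf n) b| ≤ B₁ * (α₀ + α₁) * (((geomT D).len (blkV1 hN D b) * |cf|⁻¹) ^ 1)⁻¹) ∧
            (∀ (ν : Fin (d + 1)) (b : PBond (PV d ℓ m K hd hL) 0),
              |DV (P := PV d ℓ m K hd hL) ν cf (WithLp.ofLp ((A' - dE cf g) - dE cf n)) b| ≤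
                B₁ * (α₀ + α₁) * (((geomT D).len (blkV1 hN D b) * |cf|⁻¹) ^ 2)⁻¹) ∧
            (∀ b : PBond (PV d ℓ m K hd hL) 0,
              |laplace cf (fun z => ((A' - dE cf g) - dE cf n) ⟨z, b.dir⟩) b.src| ≤
                B₁ * (α₀ + α₁) * (((geomT D).len (blkV1 hN D b) * |cf|⁻¹) ^ 3)⁻¹)) ∧
          -- (v) INSPECTED source size «|D^η_{U₀}f|₍₋₃₎ < γ(α₀ + α₁)»: the sup members for `A` with `B₁ ↦ B₁ + B₈γ₁`
          (∀ γ₁ : ℝ, 0 ≤ γ₁ →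
            (∀ b, |dE cf f b| ≤ γ₁ * (α₀ + α₁) * (((geomT D).len (blkV1 hN D b) * |cf|⁻¹) ^ 3)⁻¹) →
            -- (1.36): `|A|₍₋₁₎ ≦ (B₁ + B₈γ₁)(α₀ + α₁)`
            msup (ℓ + 1) k |cf|⁻¹ (-1) (fun j (b : PBond (PV d ℓ m K hd hL) 0) => j ≤ (blkV1 hN D b).1.1) (WithLp.ofLp (A' - dE cf n)) ≤
                (B₁ + B₈ * γ₁) * (α₀ + α₁) ∧
            -- (1.36): `|∇^η_{U₀}A|₍₋₂₎ ≦ (B₁ + B₈γ₁)(α₀ + α₁)`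
            msup (ℓ + 1) k |cf|⁻¹ (-2) (fun j (p : Fin (d + 1) × PBond (PV d ℓ m K hd hL) 0) => j ≤ (blkV1 hN D p.2).1.1)
                (fun p : Fin (d + 1) × PBond (PV d ℓ m K hd hL) 0 => DV (P := PV d ℓ m K hd hL) p.1 cf (WithLp.ofLp (A' - dE cf n)) p.2) ≤
                (B₁ + B₈ * γ₁) * (α₀ + α₁) ∧
            -- (1.39): `|Δ^η_{U₀}A|₍₋₃₎ ≦ (B₁ + B₈γ₁)(α₀ + α₁)`
            msup (ℓ + 1) k |cf|⁻¹ (-3) (fun j (b : PBond (PV d ℓ m K hd hL) 0) => j ≤ (blkV1 hN D b).1.1)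
                (fun b : PBond (PV d ℓ m K hd hL) 0 => laplace cf (fun z => (A' - dE cf n) ⟨z, b.dir⟩) b.src) ≤
                (B₁ + B₈ * γ₁) * (α₀ + α₁) ∧
            -- the three pointwise «on Ω_j» forms
            (∀ b : PBond (PV d ℓ m K hd hL) 0,
                |WithLp.ofLp (A' - dE cf n) b| ≤ (B₁ + B₈ * γ₁) * (α₀ + α₁) * (((geomT D).len (blkV1 hN D b) * |cf|⁻¹) ^ 1)⁻¹) ∧
            (∀ (ν : Fin (d + 1)) (b : PBond (PV d ℓ m K hd hL) 0),
                |DV (P := PV d ℓ m K hd hL) ν cf (WithLp.ofLp (A' - dE cf n)) b| ≤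
                  (B₁ + B₈ * γ₁) * (α₀ + α₁) * (((geomT D).len (blkV1 hN D b) * |cf|⁻¹) ^ 2)⁻¹) ∧
            (∀ b : PBond (PV d ℓ m K hd hL) 0,
                |laplace cf (fun z => (A' - dE cf n) ⟨z, b.dir⟩) b.src| ≤
                  (B₁ + B₈ * γ₁) * (α₀ + α₁) * (((geomT D).len (blkV1 hN D b) * |cf|⁻¹) ^ 3)⁻¹)) := by
  -- Theorem 4 (own, hypothesis-free) and the source-term bounds (§2), on a common range of rates
  obtain ⟨σ₀, hσ₀, h4⟩ := thm4_multiLevelTorus_V1 d ℓ hd hL hb₀ hb₁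
  obtain ⟨σ₁, hσ₁, h8⟩ := pureGauge_source_bounds d ℓ hd hL hb₀ hb₁
  refine ⟨min σ₀ σ₁, lt_min hσ₀ hσ₁, fun σ hσ hσle α hα0 hα1 => ?_⟩
  obtain ⟨B₀', M₄, hB₀', hM₄, hT4⟩ := h4 σ hσ (hσle.trans (min_le_left _ _)) α hα0 hα1
  obtain ⟨B₈, M₈, hB₈, hM₈, hS8⟩ := h8 σ hσ (hσle.trans (min_le_right _ _)) α hα0 hα1
  -- `B₁ = 5dL·B₀′ ≥ 1` («B₁ = 5dLB₀», Prop. 3 / Thm 4)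
  have hB₁ : (1 : ℝ) ≤ 5 * ((d : ℝ) + 1) * ((ℓ : ℝ) + 1) * B₀' := by
    have hdL : (1 : ℝ) ≤ ((d : ℝ) + 1) * ((ℓ : ℝ) + 1) :=
      one_le_mul_of_one_le_of_one_le (le_add_of_nonneg_left (Nat.cast_nonneg d)) (le_add_of_nonneg_left (Nat.cast_nonneg ℓ))
    calc (1 : ℝ) ≤ 5 * (((d : ℝ) + 1) * ((ℓ : ℝ) + 1)) * 1 := by linarith
      _ ≤ 5 * (((d : ℝ) + 1) * ((ℓ : ℝ) + 1)) * B₀' := mul_le_mul_of_nonneg_left hB₀' (by positivity)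
      _ = 5 * ((d : ℝ) + 1) * ((ℓ : ℝ) + 1) * B₀' := by ring
  obtain ⟨B₁, hB₁def⟩ : ∃ B₁ : ℝ, 5 * ((d : ℝ) + 1) * ((ℓ : ℝ) + 1) * B₀' = B₁ := ⟨_, rfl⟩
  rw [hB₁def] at hB₁
  refine ⟨B₁, B₈, max M₄ M₈, hB₁, hB₈, lt_max_of_lt_left hM₄, ?_⟩
  intro m K Mh k R P' hN D hk hk1 a hMha hM8 hR2 hP hℓ4 hMt cf hcf w hw hwb A' f hRf α₀ α₁ hα₀ hα₁ hJ hB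
  have hM4t : M₄ ≤ ((ℓ : ℝ) + 1) * Mh := le_trans (le_max_left _ _) hMt
  have hM8t : M₈ ≤ ((ℓ : ℝ) + 1) * Mh := le_trans (le_max_right _ _) hMt
  -- THE potential `g ∈ N(Q′)` of `f`
  obtain ⟨g, ⟨hg, hgf⟩, hguniq⟩ := potential_existsUnique (domT hN D hk) hcf hRf
  -- the shifted datum `A″ = A′ − ∂g` has the same data as `A′`
  obtain ⟨hQ'', hJ''⟩ := data_of_restricted (domT hN D hk) cf A' hg
  have hJ2 : ∀ b, |dcsE cf (dcE cf (A' - dE cf g)) b| ≤ 2 * α₀ * (((geomT D).len (blkV1 hN D b) * |cf|⁻¹) ^ 3)⁻¹ := by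
    intro b; rw [hJ'']; exact hJ b
  have hB2 : ∀ i, |QE (domT hN D hk) (A' - dE cf g) i| ≤
      2 * ((d : ℝ) + 1) * ((ℓ : ℝ) + 1) * α₁ * (((ℓ : ℝ) + 1) ^ (i.1.1 : ℕ) * |cf|⁻¹)⁻¹ := by
    intro i; rw [hQ'']; exact hB i
  -- Theorem 4 for `A″`
  obtain ⟨hex4, hall4⟩ := hT4 m K hN D hk hk1 hMha hM8 hR2 hP hℓ4 hM4t hcf hw hwb (A' - dE cf g) α₀ α₁ hα₀ hα₁ hJ2 hB2
  -- (i) ∃! through the equivalence (1.146) ⟺ shifted (1.38)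
  have hiff : ∀ n : ScalarSpace (PV d ℓ m K hd hL),
      (n ∈ LinearMap.ker (QpE (domT hN D hk)) ∧ RE (domT hN D hk) cf (dsE cf (A' - dE cf n)) = f) ↔
      (n ∈ LinearMap.ker (QpE (domT hN D hk)) ∧ RE (domT hN D hk) cf (dsE cf ((A' - dE cf g) - dE cf n)) = 0) :=
    fun n => and_congr_right fun _ => sourced_iff_landau_shift (domT hN D hk) cf hg hgf A' n
  refine ⟨(existsUnique_congr hiff).mpr hex4, fun n hn h146 => ?_⟩
  -- the Landau condition for `A″`, and Theorem 4's members for `A_L := A″ − ∂λ`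
  have hLan : RE (domT hN D hk) cf (dsE cf ((A' - dE cf g) - dE cf n)) = 0 :=
    (sourced_iff_landau_shift (domT hN D hk) cf hg hgf A' n).mp h146
  obtain ⟨h37L, h55L, hA1L, hA2L, hJ3L, hA4L, hp1L, hp2L, hp3L⟩ := hall4 n hn hLan
  beta_reduce at hJ3L hp1L hp2L hp3L
  rw [hB₁def] at hJ3L hp1L hp2L hp3L
  -- (ii) for `A` itself (λ is restricted)
  obtain ⟨h37, h55⟩ := data_of_restricted (domT hN D hk) cf A' hn
  -- (iii) `D*DA = D*DA′ = D*DA″ = D*D A_L`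
  have hJ3 : ∀ b : PBond (PV d ℓ m K hd hL) 0,
      |dcsE cf (dcE cf (A' - dE cf n)) b| ≤ B₁ * (α₀ + α₁) * (((geomT D).len (blkV1 hN D b) * |cf|⁻¹) ^ 3)⁻¹ := by
    intro b
    have hre : dcsE cf (dcE cf (A' - dE cf n)) = dcsE cf (dcE cf ((A' - dE cf g) - dE cf n)) := by
      rw [h55, h55L, hJ'']
    rw [hre]
    exact hJ3L b
  have hsplit : A' - dE cf n = ((A' - dE cf g) - dE cf n) + dE cf g := sub_dE_eq_shift_add cf A' g n
  refine ⟨h37, h55, hJ3, ⟨g, hg, hgf, hLan, hsplit, hp1L, hp2L, hp3L⟩, fun γ₁ hγ₁ hDf => ?_⟩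
  -- (v) the inspected size: bounds on the source term `∂g` (§2) with `S := γ₁(α₀ + α₁)`
  have hS0 : 0 ≤ γ₁ * (α₀ + α₁) := mul_nonneg hγ₁ (add_nonneg hα₀ hα₁)
  have hX : ∀ b, |dE cf (lapE cf g) b| ≤ γ₁ * (α₀ + α₁) * (((geomT D).len (blkV1 hN D b) * |cf|⁻¹) ^ 3)⁻¹ := by
    intro b; rw [hgf]; exact hDf b
  have hsrc := hS8 m K hN D hk hk1 hMha hM8 hR2 hP hℓ4 hM8t hcf hw hwb g hg (γ₁ * (α₀ + α₁)) hS0 hX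
  have hη : 0 < |cf|⁻¹ := inv_pos.2 (abs_pos.2 hcf)
  -- pointwise members of `A = A_L + ∂g`
  have hC : 0 ≤ (B₁ + B₈ * γ₁) * (α₀ + α₁) :=
    mul_nonneg (add_nonneg (zero_le_one.trans hB₁) (mul_nonneg (zero_le_one.trans hB₈) hγ₁)) (add_nonneg hα₀ hα₁)
  have hp1 : ∀ b : PBond (PV d ℓ m K hd hL) 0,
      |WithLp.ofLp (A' - dE cf n) b| ≤ (B₁ + B₈ * γ₁) * (α₀ + α₁) * (((geomT D).len (blkV1 hN D b) * |cf|⁻¹) ^ 1)⁻¹ := by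
    intro b
    obtain ⟨hs1, -, -⟩ := hsrc b
    rw [hsplit, WithLp.ofLp_add, Pi.add_apply]
    calc |WithLp.ofLp ((A' - dE cf g) - dE cf n) b + WithLp.ofLp (dE cf g) b|
        ≤ |WithLp.ofLp ((A' - dE cf g) - dE cf n) b| + |WithLp.ofLp (dE cf g) b| := abs_add_le _ _
      _ ≤ B₁ * (α₀ + α₁) * (((geomT D).len (blkV1 hN D b) * |cf|⁻¹) ^ 1)⁻¹ +
            B₈ * (γ₁ * (α₀ + α₁)) * (((geomT D).len (blkV1 hN D b) * |cf|⁻¹) ^ 1)⁻¹ := add_le_add (hp1L b) hs1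
      _ = (B₁ + B₈ * γ₁) * (α₀ + α₁) * (((geomT D).len (blkV1 hN D b) * |cf|⁻¹) ^ 1)⁻¹ := by ring
  have hp2 : ∀ (ν : Fin (d + 1)) (b : PBond (PV d ℓ m K hd hL) 0),
      |DV (P := PV d ℓ m K hd hL) ν cf (WithLp.ofLp (A' - dE cf n)) b| ≤
        (B₁ + B₈ * γ₁) * (α₀ + α₁) * (((geomT D).len (blkV1 hN D b) * |cf|⁻¹) ^ 2)⁻¹ := by
    intro ν b
    obtain ⟨-, hs2, -⟩ := hsrc b
    rw [hsplit, WithLp.ofLp_add, map_add, Pi.add_apply]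
    calc |DV (P := PV d ℓ m K hd hL) ν cf (WithLp.ofLp ((A' - dE cf g) - dE cf n)) b +
            DV (P := PV d ℓ m K hd hL) ν cf (WithLp.ofLp (dE cf g)) b|
        ≤ |DV (P := PV d ℓ m K hd hL) ν cf (WithLp.ofLp ((A' - dE cf g) - dE cf n)) b| +
            |DV (P := PV d ℓ m K hd hL) ν cf (WithLp.ofLp (dE cf g)) b| := abs_add_le _ _
      _ ≤ B₁ * (α₀ + α₁) * (((geomT D).len (blkV1 hN D b) * |cf|⁻¹) ^ 2)⁻¹ +
            B₈ * (γ₁ * (α₀ + α₁)) * (((geomT D).len (blkV1 hN D b) * |cf|⁻¹) ^ 2)⁻¹ := add_le_add (hp2L ν b) (hs2 ν)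
      _ = (B₁ + B₈ * γ₁) * (α₀ + α₁) * (((geomT D).len (blkV1 hN D b) * |cf|⁻¹) ^ 2)⁻¹ := by ring
  have hp3 : ∀ b : PBond (PV d ℓ m K hd hL) 0,
      |laplace cf (fun z => (A' - dE cf n) ⟨z, b.dir⟩) b.src| ≤
        (B₁ + B₈ * γ₁) * (α₀ + α₁) * (((geomT D).len (blkV1 hN D b) * |cf|⁻¹) ^ 3)⁻¹ := by
    intro b
    obtain ⟨-, -, hs3⟩ := hsrc b
    have hw3 : 0 ≤ (((geomT D).len (blkV1 hN D b) * |cf|⁻¹) ^ 3)⁻¹ :=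
      inv_nonneg.2 (pow_nonneg (mul_nonneg (lenT_pos D _).le hη.le) 3)
    have hfun : (fun z : Site (PV d ℓ m K hd hL) 0 => (A' - dE cf n) ⟨z, b.dir⟩) =
        fun z => ((A' - dE cf g) - dE cf n) ⟨z, b.dir⟩ + (dE cf g) ⟨z, b.dir⟩ := by
      funext z
      rw [hsplit]
      rfl
    rw [hfun, laplace_add']
    calc |laplace cf (fun z => ((A' - dE cf g) - dE cf n) ⟨z, b.dir⟩) b.src + laplace cf (fun z => (dE cf g) ⟨z, b.dir⟩) b.src|
        ≤ |laplace cf (fun z => ((A' - dE cf g) - dE cf n) ⟨z, b.dir⟩) b.src| + |laplace cf (fun z => (dE cf g) ⟨z, b.dir⟩) b.src| :=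
          abs_add_le _ _
      _ ≤ B₁ * (α₀ + α₁) * (((geomT D).len (blkV1 hN D b) * |cf|⁻¹) ^ 3)⁻¹ +
            γ₁ * (α₀ + α₁) * (((geomT D).len (blkV1 hN D b) * |cf|⁻¹) ^ 3)⁻¹ := add_le_add (hp3L b) hs3
      _ = (B₁ * (α₀ + α₁) + γ₁ * (α₀ + α₁)) * (((geomT D).len (blkV1 hN D b) * |cf|⁻¹) ^ 3)⁻¹ := by ring
      _ ≤ (B₁ * (α₀ + α₁) + B₈ * γ₁ * (α₀ + α₁)) * (((geomT D).len (blkV1 hN D b) * |cf|⁻¹) ^ 3)⁻¹ := by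
          have hγB : γ₁ ≤ B₈ * γ₁ := le_mul_of_one_le_left hγ₁ hB₈
          have hγ : γ₁ * (α₀ + α₁) ≤ B₈ * γ₁ * (α₀ + α₁) := mul_le_mul_of_nonneg_right hγB (add_nonneg hα₀ hα₁)
          exact mul_le_mul_of_nonneg_right (add_le_add le_rfl hγ) hw3
      _ = (B₁ + B₈ * γ₁) * (α₀ + α₁) * (((geomT D).len (blkV1 hN D b) * |cf|⁻¹) ^ 3)⁻¹ := by ring
  -- print's norms from the pointwise forms
  have e1 : (-1 : ℝ) = -((1 : ℕ) : ℝ) := by norm_num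
  have e2 : (-2 : ℝ) = -((2 : ℕ) : ℝ) := by norm_num
  have e3 : (-3 : ℝ) = -((3 : ℕ) : ℝ) := by norm_num
  refine ⟨?_, ?_, ?_, hp1, hp2, hp3⟩
  · rw [e1]
    exact msup_le_of_pointwise_blk_eta D (blkV1 hN D) 1 hη hC hp1
  · rw [e2]
    exact msup_le_of_pointwise_blk_eta D (fun p : Fin (d + 1) × PBond (PV d ℓ m K hd hL) 0 => blkV1 hN D p.2) 2 hη hC
      fun p => hp2 p.1 p.2
  · rw [e3]
    exact msup_le_of_pointwise_blk_eta D (blkV1 hN D) 3 hη hC hp3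

/-! ## §4 Theorem 8's sentence, packaged -/

open Classical in
/-- **THEOREM 8 AT `U₀ = 1` ON THE `k`-LEVEL V1 TORUS, PACKAGED AS ITS SENTENCE** (the form of own `thm2_multiLevelTorus_V1`): under the
inspected source size — «f from the space R(U₀)» with `|(∂f)(b)| ≦ γ₁(α₀ + α₁)((L^{j(b)})η)⁻³` — there is EXACTLY ONE restricted `λ ∈ N(Q′)`
[(1.29)] with `R∂*(A′ − ∂λ) = f` [(1.146)], and for it: (1.37) `QA = QA′`; (1.36) `|A|₍₋₁₎, |∇^η_{U₀}A|₍₋₂₎ ≦ (B₁ + B₈γ₁)(α₀ + α₁)`; (1.39)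
`|D^{η*}_{U₀}D^η_{U₀}A| ≦ B₁(α₀ + α₁)(Lʲη)⁻³ on Ω_j`, `|Δ^η_{U₀}A|₍₋₃₎ ≦ (B₁ + B₈γ₁)(α₀ + α₁)` («The constants B₁, B₂(β₀) are as in Theorems 2, 4»
— here `B₁` of `thm4_multiLevelTorus_V1` with the numerical change `+ B₈γ₁`, HONEST SCOPE (iv); the Hölder member is not part of the instance).
[cite: Balaban1985RegularSpaces, Thm 8 + (1.146) p.101, (1.36)–(1.38) p.82, (1.39) p.83, (1.29) p.81, Thm 4 p.88; Balaban1984PropagatorsII, (2.7) p.224, (2.12) p.225] -/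
theorem thm8_multiLevelTorus_V1_inspected (d ℓ : ℕ) (hd : 1 ≤ d + 1) (hL : Odd (ℓ + 1) ∧ 1 < ℓ + 1) {b₀ b₁ : ℝ} (hb₀ : 0 < b₀)
    (hb₁ : b₀ ≤ b₁) :
    ∃ σ₀ : ℝ, 0 < σ₀ ∧ ∀ (σ : ℝ), 0 < σ → σ ≤ σ₀ → ∀ (α : ℝ), 0 < α → α < 1 →
    ∃ B₁ B₈ M₈ : ℝ, 1 ≤ B₁ ∧ 1 ≤ B₈ ∧ 0 < M₈ ∧
    ∀ (m K : ℕ) {Mh k R : ℕ} {P' : Fin (d + 1) → ℕ}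
      (hN : ∀ μ, N0 ℓ Mh k P' μ = (PV d ℓ m K hd hL).sitesPerDir 0) (D : TDomains d ℓ Mh k P' R) (hk : k ≤ m + K) (_ : 1 ≤ k)
      {a : ℕ} (_ : Mh = (ℓ + 1) ^ a) (_ : 8 ≤ Mh) (_ : 2 * (ℓ + 1) ^ 2 ≤ R) (_ : ∀ μ, 5 * (ℓ + 1) ≤ P' μ) (_ : 4 ≤ ℓ)
      (_ : M₈ ≤ ((ℓ : ℝ) + 1) * Mh)
      {cf : ℝ} (hcf : cf ≠ 0) {w : BondIdx (domT hN D hk) → ℝ} (_ : ∀ i, 0 < w i) (_ : GlobalBand b₀ b₁ cf w),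
      ∀ (A' : BondSpace (PV d ℓ m K hd hL)) (f : ScalarSpace (PV d ℓ m K hd hL)),
        RE (domT hN D hk) cf f = f →
        ∀ (α₀ α₁ γ₁ : ℝ), 0 ≤ α₀ → 0 ≤ α₁ → 0 ≤ γ₁ →
        (∀ b, |dcsE cf (dcE cf A') b| ≤ 2 * α₀ * (((geomT D).len (blkV1 hN D b) * |cf|⁻¹) ^ 3)⁻¹) →
        (∀ i, |QE (domT hN D hk) A' i| ≤ 2 * ((d : ℝ) + 1) * ((ℓ : ℝ) + 1) * α₁ * (((ℓ : ℝ) + 1) ^ (i.1.1 : ℕ) * |cf|⁻¹)⁻¹) →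
        (∀ b, |dE cf f b| ≤ γ₁ * (α₀ + α₁) * (((geomT D).len (blkV1 hN D b) * |cf|⁻¹) ^ 3)⁻¹) →
        ∃! n : ScalarSpace (PV d ℓ m K hd hL),
          -- (1.29) restricted, (1.146) the gauge condition with the source `f`
          n ∈ LinearMap.ker (QpE (domT hN D hk)) ∧ RE (domT hN D hk) cf (dsE cf (A' - dE cf n)) = f ∧
          -- (1.37)
          QE (domT hN D hk) (A' - dE cf n) = QE (domT hN D hk) A' ∧
          -- (1.36) sup members
          msup (ℓ + 1) k |cf|⁻¹ (-1) (fun j (b : PBond (PV d ℓ m K hd hL) 0) => j ≤ (blkV1 hN D b).1.1) (WithLp.ofLp (A' - dE cf n)) ≤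
              (B₁ + B₈ * γ₁) * (α₀ + α₁) ∧
          msup (ℓ + 1) k |cf|⁻¹ (-2) (fun j (p : Fin (d + 1) × PBond (PV d ℓ m K hd hL) 0) => j ≤ (blkV1 hN D p.2).1.1)
              (fun p : Fin (d + 1) × PBond (PV d ℓ m K hd hL) 0 => DV (P := PV d ℓ m K hd hL) p.1 cf (WithLp.ofLp (A' - dE cf n)) p.2) ≤
              (B₁ + B₈ * γ₁) * (α₀ + α₁) ∧
          -- (1.39)
          (∀ b : PBond (PV d ℓ m K hd hL) 0,
              |dcsE cf (dcE cf (A' - dE cf n)) b| ≤ B₁ * (α₀ + α₁) * (((geomT D).len (blkV1 hN D b) * |cf|⁻¹) ^ 3)⁻¹) ∧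
          msup (ℓ + 1) k |cf|⁻¹ (-3) (fun j (b : PBond (PV d ℓ m K hd hL) 0) => j ≤ (blkV1 hN D b).1.1)
              (fun b : PBond (PV d ℓ m K hd hL) 0 => laplace cf (fun z => (A' - dE cf n) ⟨z, b.dir⟩) b.src) ≤
              (B₁ + B₈ * γ₁) * (α₀ + α₁) := by
  obtain ⟨σ₀, hσ₀, h8⟩ := thm8_multiLevelTorus_V1 d ℓ hd hL hb₀ hb₁
  refine ⟨σ₀, hσ₀, fun σ hσ hσle α hα0 hα1 => ?_⟩
  obtain ⟨B₁, B₈, M₈, hB₁, hB₈, hM₈, h⟩ := h8 σ hσ hσle α hα0 hα1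
  refine ⟨B₁, B₈, M₈, hB₁, hB₈, hM₈, ?_⟩
  intro m K Mh k R P' hN D hk hk1 a hMha hM8 hR2 hP hℓ4 hMt cf hcf w hw hwb A' f hRf α₀ α₁ γ₁ hα₀ hα₁ hγ₁ hJ hB hDf
  obtain ⟨⟨n, ⟨hn, h146⟩, huniq⟩, hall⟩ :=
    h m K hN D hk hk1 hMha hM8 hR2 hP hℓ4 hMt hcf hw hwb A' f hRf α₀ α₁ hα₀ hα₁ hJ hB
  obtain ⟨h37, -, hJ3, -, hins⟩ := hall n hn h146
  obtain ⟨hA1, hA2, hA4, -, -, -⟩ := hins γ₁ hγ₁ hDf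
  exact ⟨n, ⟨hn, h146, h37, hA1, hA2, hJ3, hA4⟩, fun n' h' => huniq n' ⟨h'.1, h'.2.1⟩⟩

/-! ## §5 The `|A|`-member under print's OWN source size `|f|₍₋₂₎ < γ(α₀ + α₁)`: the scalar `G′` of [4] Thm 3.1 at `U₀ = 1` through r03's chart -/

section Scalar

variable {d ℓ : ℕ} {m K : ℕ} {hd : 1 ≤ d + 1} {hL : Odd (ℓ + 1) ∧ 1 < ℓ + 1} {Mh k R : ℕ} {P' : Fin (d + 1) → ℕ}
  (hN : ∀ μ, N0 ℓ Mh k P' μ = (PV d ℓ m K hd hL).sitesPerDir 0) (D : TDomains d ℓ Mh k P' R) (hk : k ≤ m + K)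

include hk in
/-- **THE POTENTIAL IS `G′f`** (p. 93: «G′ is a bounded operator …»; [B6] p. 225: «Rf = Δλ = Δ′_aλ = f», (2.17) «The operator G′ = Δ′_a⁻¹ is a well
defined, positive operator», `Δ′_a = Δ + Q′*aQ′` (2.13)): for `g ∈ N(Q′)` with `Δg = f`, `Δ′_ag = Δg + Q′*aQ′g = f`, so `g = G′f` — read on the V1 site functions with r03's charted `G′ = GpV` of p21's genuine `k`-level torus matrix
`gmlT` (the averaging part of `Δ′_a` vanishes on `N(Q′)`: `B6ScalarChartV1.mlOpT_mulVec_of_QB_eq_zero`). [cite: Balaban1985RegularSpaces, (1.100)–(1.101) p.93; Balaban1984PropagatorsII, (2.13)–(2.17) p.225] -/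
theorem potential_fun_eq_GpV (hℓ : 1 ≤ ℓ) (hMh : 1 ≤ Mh) (hP : ∀ μ, 1 ≤ P' μ) {cf : ℝ} (hcf : cf ≠ 0)
    {f g : ScalarSpace (PV d ℓ m K hd hL)} (hg : g ∈ LinearMap.ker (QpE (domT hN D hk))) (hgf : lapE cf g = f) :
    WithLp.ofLp g = GpV hN D cf (WithLp.ofLp f) := by
  -- the box reading `gb` of `g` and its vanishing block averages
  set gb : ↥(boxDom (N0 ℓ Mh k P')) → ℝ := fun z => WithLp.ofLp g ((boxEquiv hN).symm z)
  have hback : (WithLp.toLp 2 fun x : Site (PV d ℓ m K hd hL) 0 => gb (toBox hN x)) = g :=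
    PiLp.ext fun x => congrArg (WithLp.ofLp g) (boxEquiv_symm_toBox hN x)
  have hQB : QB D.toDomains gb = 0 := by
    have h := (chart_mem_ker_QpE_iff hN D hk gb).mp
    rw [hback] at h
    exact h hg
  -- `Δ′_a g = Δg = f` on the V1 functions
  have hDp : DpV hN D cf (WithLp.ofLp g) = WithLp.ofLp f := by
    funext x
    unfold DpV
    rw [LinearMap.smul_apply, Pi.smul_apply, smul_eq_mul, chartOp_apply]
    change cf ^ 2 * (Matrix.mulVec (dP D) gb) (toBox hN x) = WithLp.ofLp f x
    rw [mlOpT_mulVec_of_QB_eq_zero D (aPrinted ℓ 1) hQB, ← lapE_chart hN cf gb x, hback, hgf]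
  -- `g = G′Δ′_ag = G′f`
  have h1 := congrArg (fun T : Module.End ℝ (Site (PV d ℓ m K hd hL) 0 → ℝ) => T (WithLp.ofLp g)) (GpV_mul_DpV hN D hℓ hMh hP hcf)
  simp only [Module.End.mul_apply, Module.End.one_apply] at h1
  rw [hDp] at h1
  exact h1.symm

include hk in
/-- … hence **the source term is `∂G′f`** read on functions: `∂g = (∂ ∘ G′)f`. [cite: Balaban1985RegularSpaces, (1.100)–(1.101) p.93; Balaban1984PropagatorsII, (2.17) p.225] -/
theorem dE_potential_fun_eq (hℓ : 1 ≤ ℓ) (hMh : 1 ≤ Mh) (hP : ∀ μ, 1 ≤ P' μ) {cf : ℝ} (hcf : cf ≠ 0)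
    {f g : ScalarSpace (PV d ℓ m K hd hL)} (hg : g ∈ LinearMap.ker (QpE (domT hN D hk))) (hgf : lapE cf g = f) :
    WithLp.ofLp (dE cf g) = (onFun (dE (P := PV d ℓ m K hd hL) cf) ∘ₗ GpV hN D cf) (WithLp.ofLp f) := by
  rw [LinearMap.comp_apply, ← potential_fun_eq_GpV hN D hk hℓ hMh hP hcf hg hgf]
  funext b
  rw [B6Ineq2133TwoScaleV1.onFun_apply, WithLp.toLp_ofLp]

end Scalar

open Classical in
/-- **p. 93 AT `U₀ = 1` ON THE `k`-LEVEL V1 TORUS, FOR THE SOURCE'S POTENTIAL: `|∂G′f|₍₋₁₎ ≦ B′₀|f|₍₋₂₎`** («One of the results of [4], Theorem 3.1,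
tells us that G′ is a bounded operator from a space with the norm |·|₍₋₂₎ into a space with … the norm |·|₍₋₁₎ for their first derivatives»):
there are ONE constant `B′₀ ≥ 1` and ONE threshold `M′ > 0` (on `d, L`) such that on every `k`-level V1 torus of the family (`P′ ≥ 4`, `R ≥ 2L`,
`M′ ≤ L·M_h`, `L ≥ 2`), for every `c′ ≠ 0` and every restricted potential `g ∈ N(Q′)` of `f = Δg` with `|f(x)| ≦ S((L^{j(x)})η)⁻²` (`η = |c′|⁻¹`):
`|(∂g)(b)| ≦ B′₀S((L^{j(b)})η)⁻¹` — r03's charted (2.67) majorant of `∂G′` (`B6ScalarFactorsChartV1.factors_V1`, p21's Prop. 2.2 torus census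
underneath) fed to the [4] (3.47) / Lemma-2.1 engine `sup347_eta` on the SITE carrier (direction by direction). HYPOTHESIS-FREE.
[cite: Balaban1985RegularSpaces, (1.101) p.93, (1.36) p.82; Balaban1985BackgroundPropagators, Theorem 3.1 (3.42) p.397, (3.47) p.398; Balaban1984PropagatorsII, Prop. 2.2 (2.67) p.234, Lemma 2.1 (2.60)–(2.61) p.234] -/
theorem dE_potential_bound_printed (d ℓ : ℕ) (hd : 1 ≤ d + 1) (hL : Odd (ℓ + 1) ∧ 1 < ℓ + 1) :
    ∃ B₀' M' : ℝ, 1 ≤ B₀' ∧ 0 < M' ∧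
    ∀ (m K : ℕ) {Mh k R : ℕ} {P' : Fin (d + 1) → ℕ}
      (hN : ∀ μ, N0 ℓ Mh k P' μ = (PV d ℓ m K hd hL).sitesPerDir 0) (D : TDomains d ℓ Mh k P' R) (hk : k ≤ m + K)
      (_ : ∀ μ, 4 ≤ P' μ) (_ : 2 * (ℓ + 1) ≤ R) (_ : M' ≤ ((ℓ : ℝ) + 1) * Mh)
      {cf : ℝ} (_ : cf ≠ 0),
      ∀ (f g : ScalarSpace (PV d ℓ m K hd hL)), g ∈ LinearMap.ker (QpE (domT hN D hk)) → lapE cf g = f →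
      ∀ (S : ℝ), 0 ≤ S →
        (∀ x : Site (PV d ℓ m K hd hL) 0, |WithLp.ofLp f x| ≤ S * (((geomT D).len (blkS hN D x) * |cf|⁻¹) ^ 2)⁻¹) →
        ∀ b : PBond (PV d ℓ m K hd hL) 0,
          |WithLp.ofLp (dE cf g) b| ≤ B₀' * S * (((geomT D).len (blkV1 hN D b) * |cf|⁻¹) ^ 1)⁻¹ := by
  have hℓ : 1 ≤ ℓ := by have := hL.2; omega
  -- r03's charted (2.67)/(2.87) factor majorants, and the engine at their decay rate
  obtain ⟨M₁, δ, C, hM₁, hδ, hC, hfac⟩ := factors_V1 d ℓ hd hL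
  obtain ⟨B₀, N₁, hB₀, hN₁, heng⟩ := sup347_eta d ℓ hδ 2
  refine ⟨B₀ * C + 1, max M₁ ((N₁ : ℝ) + 1), le_add_of_nonneg_left (mul_nonneg (by linarith) hC.le), lt_max_of_lt_left hM₁, ?_⟩
  intro m K Mh k R P' hN D hk hP4 hR hMt cf hcf f g hg hgf S hS hf b
  have hM1t : M₁ ≤ ((ℓ : ℝ) + 1) * Mh := le_trans (le_max_left _ _) hMt
  have hN1r : (N₁ : ℝ) + 1 ≤ ((ℓ : ℝ) + 1) * Mh := le_trans (le_max_right _ _) hMt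
  have hP1 : ∀ μ, 1 ≤ P' μ := fun μ => le_trans (by norm_num) (hP4 μ)
  have hMh1 : 1 ≤ Mh := by
    by_contra h0
    have h0' : Mh = 0 := by omega
    rw [h0', Nat.cast_zero, mul_zero] at hN1r
    have : (0 : ℝ) ≤ (N₁ : ℝ) := Nat.cast_nonneg N₁
    linarith
  have hN1t : N₁ + 1 ≤ R * ((ℓ + 1) * Mh) := by
    have h1 : N₁ + 1 ≤ (ℓ + 1) * Mh := by exact_mod_cast hN1r
    have hR1 : 1 ≤ R := le_trans (by omega) hR
    calc N₁ + 1 ≤ (ℓ + 1) * Mh := h1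
      _ = 1 * ((ℓ + 1) * Mh) := (one_mul _).symm
      _ ≤ R * ((ℓ + 1) * Mh) := Nat.mul_le_mul_right _ hR1
  have hη : 0 < |cf|⁻¹ := inv_pos.2 (abs_pos.2 hcf)
  obtain ⟨-, hdG, -, -⟩ := hfac m K hN D hP4 hR hM1t hcf
  -- direction by direction: the site operator `h ↦ (∂G′h)(·, μ)` has the majorant `C·(len·η)·e^{−δd}` on the site blocks
  let Tμ : Fin (d + 1) → Module.End ℝ (Site (PV d ℓ m K hd hL) 0 → ℝ) := fun μ =>
    LinearMap.funLeft ℝ ℝ (fun x : Site (PV d ℓ m K hd hL) 0 => (⟨x, μ⟩ : PBond (PV d ℓ m K hd hL) 0)) ∘ₗ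
      (onFun (dE (P := PV d ℓ m K hd hL) cf) ∘ₗ GpV hN D cf)
  have hT : ∀ μ, HasMajorant (g := geomT D) (blkS hN D) (Tμ μ)
      (fun y y' => C * ((geomT D).len y * |cf|⁻¹) ^ 1 * Real.exp (-(δ * (geomT D).dist y y'))) := by
    intro μ y' u B hu x
    have h1 := hdG y' u B hu ⟨x, μ⟩
    have e : blkV1 hN D (⟨x, μ⟩ : PBond (PV d ℓ m K hd hL) 0) = blkS hN D x := blkV1_eq_blkS hN D _
    rw [e] at h1
    refine (le_of_eq ?_).trans (h1.trans (le_of_eq (by ring)))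
    rfl
  -- the engine, `n = 2`, `p = 1`
  have key := fun μ => heng k Mh R hMh1 hN1t P' hP1 D |cf|⁻¹ hη 1 (Site (PV d ℓ m K hd hL) 0) (blkS hN D) (Tμ μ) C hC.le (hT μ)
    (WithLp.ofLp f) S hS hf
  -- at the bond `b = ⟨b.src, b.dir⟩`
  have hval : WithLp.ofLp (dE cf g) b = Tμ b.dir (WithLp.ofLp f) b.src := by
    rw [dE_potential_fun_eq hN D hk hℓ hMh1 hP1 hcf hg hgf]
    rfl
  have hw : 0 ≤ (((geomT D).len (blkV1 hN D b) * |cf|⁻¹) ^ 1)⁻¹ :=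
    inv_nonneg.2 (pow_nonneg (mul_nonneg (lenT_pos D _).le hη.le) 1)
  rw [hval]
  have e : blkS hN D b.src = blkV1 hN D b := (blkV1_eq_blkS hN D b).symm
  calc |Tμ b.dir (WithLp.ofLp f) b.src|
      ≤ B₀ * C * ((geomT D).len (blkS hN D b.src) * |cf|⁻¹) ^ 1 * (((geomT D).len (blkS hN D b.src) * |cf|⁻¹) ^ 2)⁻¹ * S :=
        key b.dir b.src
    _ = B₀ * C * S * (((geomT D).len (blkV1 hN D b) * |cf|⁻¹) ^ 1)⁻¹ := by
        rw [e]
        have hm : 0 < (geomT D).len (blkV1 hN D b) * |cf|⁻¹ := mul_pos (lenT_pos D _) hη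
        field_simp
    _ ≤ (B₀ * C + 1) * S * (((geomT D).len (blkV1 hN D b) * |cf|⁻¹) ^ 1)⁻¹ :=
        mul_le_mul_of_nonneg_right (mul_le_mul_of_nonneg_right (by linarith) hS) hw

open Classical in
/-- **THEOREM 8 AT `U₀ = 1` ON THE `k`-LEVEL V1 TORUS UNDER PRINT'S OWN SOURCE SIZE `|f|₍₋₂₎ < γ(α₀ + α₁)` — THE SURVIVING PART** (the cell's
adjudication G-B8-13 / b08's `B8.Thm8Inspected`: the restricted `u` with (1.146), (1.37) and the `|A|`-clause of (1.36), unique among such):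
for the weight band there is `σ₀ > 0` such that for all `σ ∈ (0, σ₀]`, `α ∈ (0, 1)` there are `B₁ ≥ 1` («as in Theorems 2, 4»), `B′₀ ≥ 1` (p. 93's
constant of `G′` at `U₀ = 1`) and ONE threshold `M > 0` such that on every admissible `k`-level V1 torus, for every datum `A′` with Theorem 4's
processed sizes and EVERY «function f from the space R(U₀) satisfying the bound |f|₍₋₂₎ < γ(α₀ + α₁)» — `Rf = f`, `|f(x)| ≦ γ(α₀ + α₁)((L^{j(x)})η)⁻²`,
`γ ≥ 0`: «there exists exactly one gauge transformation u satisfying (1.29) and such, that … (1.146)» — `∃! λ ∈ N(Q′)`, `R∂*(A′ − ∂λ) = f` — and for it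
(1.37) `QA = QA′`, the `|A|`-member of (1.36) `|A|₍₋₁₎ ≦ (B₁ + B′₀γ)(α₀ + α₁)` («only some constants change their numerical values») with its pointwise
form, and the `D^{η*}D^η`-member of (1.39) `≦ B₁(α₀ + α₁)(Lʲη)⁻³`.  The `∇`-, Hölder- and `Δ`-members are NOT asserted under this hypothesis
(G-B8-13; they hold under the inspected size of `thm8_multiLevelTorus_V1` (v)). [cite: Balaban1985RegularSpaces, Thm 8 + (1.146) p.101, (1.36)–(1.38) p.82, (1.39) p.83, (1.29) p.81, (1.101) p.93, Thm 4 p.88; Balaban1984PropagatorsII, (2.7) p.224, (2.12) + (2.17) p.225, Prop. 2.2 (2.67) p.234] -/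
theorem thm8_multiLevelTorus_V1_surviving (d ℓ : ℕ) (hd : 1 ≤ d + 1) (hL : Odd (ℓ + 1) ∧ 1 < ℓ + 1) {b₀ b₁ : ℝ} (hb₀ : 0 < b₀)
    (hb₁ : b₀ ≤ b₁) :
    ∃ σ₀ : ℝ, 0 < σ₀ ∧ ∀ (σ : ℝ), 0 < σ → σ ≤ σ₀ → ∀ (α : ℝ), 0 < α → α < 1 →
    ∃ B₁ B₀' M : ℝ, 1 ≤ B₁ ∧ 1 ≤ B₀' ∧ 0 < M ∧
    ∀ (m K : ℕ) {Mh k R : ℕ} {P' : Fin (d + 1) → ℕ}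
      (hN : ∀ μ, N0 ℓ Mh k P' μ = (PV d ℓ m K hd hL).sitesPerDir 0) (D : TDomains d ℓ Mh k P' R) (hk : k ≤ m + K) (_ : 1 ≤ k)
      {a : ℕ} (_ : Mh = (ℓ + 1) ^ a) (_ : 8 ≤ Mh) (_ : 2 * (ℓ + 1) ^ 2 ≤ R) (_ : ∀ μ, 5 * (ℓ + 1) ≤ P' μ) (_ : 4 ≤ ℓ)
      (_ : M ≤ ((ℓ : ℝ) + 1) * Mh)
      {cf : ℝ} (hcf : cf ≠ 0) {w : BondIdx (domT hN D hk) → ℝ} (_ : ∀ i, 0 < w i) (_ : GlobalBand b₀ b₁ cf w),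
      ∀ (A' : BondSpace (PV d ℓ m K hd hL)) (f : ScalarSpace (PV d ℓ m K hd hL)),
        RE (domT hN D hk) cf f = f →
        ∀ (α₀ α₁ γ : ℝ), 0 ≤ α₀ → 0 ≤ α₁ → 0 ≤ γ →
        (∀ b, |dcsE cf (dcE cf A') b| ≤ 2 * α₀ * (((geomT D).len (blkV1 hN D b) * |cf|⁻¹) ^ 3)⁻¹) →
        (∀ i, |QE (domT hN D hk) A' i| ≤ 2 * ((d : ℝ) + 1) * ((ℓ : ℝ) + 1) * α₁ * (((ℓ : ℝ) + 1) ^ (i.1.1 : ℕ) * |cf|⁻¹)⁻¹) →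
        -- print's own source size: `|f|₍₋₂₎ ≦ γ(α₀ + α₁)`
        (∀ x : Site (PV d ℓ m K hd hL) 0, |WithLp.ofLp f x| ≤ γ * (α₀ + α₁) * (((geomT D).len (blkS hN D x) * |cf|⁻¹) ^ 2)⁻¹) →
        ∃! n : ScalarSpace (PV d ℓ m K hd hL),
          -- (1.29) restricted, (1.146)
          n ∈ LinearMap.ker (QpE (domT hN D hk)) ∧ RE (domT hN D hk) cf (dsE cf (A' - dE cf n)) = f ∧
          -- (1.37)
          QE (domT hN D hk) (A' - dE cf n) = QE (domT hN D hk) A' ∧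
          -- (1.36), the `|A|`-member: `|A|₍₋₁₎ ≦ (B₁ + B′₀γ)(α₀ + α₁)`, and pointwise «on Ω_j»
          msup (ℓ + 1) k |cf|⁻¹ (-1) (fun j (b : PBond (PV d ℓ m K hd hL) 0) => j ≤ (blkV1 hN D b).1.1) (WithLp.ofLp (A' - dE cf n)) ≤
              (B₁ + B₀' * γ) * (α₀ + α₁) ∧
          (∀ b : PBond (PV d ℓ m K hd hL) 0,
              |WithLp.ofLp (A' - dE cf n) b| ≤ (B₁ + B₀' * γ) * (α₀ + α₁) * (((geomT D).len (blkV1 hN D b) * |cf|⁻¹) ^ 1)⁻¹) ∧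
          -- (1.39), the `D^{η*}D^η`-member, exactly as in Theorem 4
          (∀ b : PBond (PV d ℓ m K hd hL) 0,
              |dcsE cf (dcE cf (A' - dE cf n)) b| ≤ B₁ * (α₀ + α₁) * (((geomT D).len (blkV1 hN D b) * |cf|⁻¹) ^ 3)⁻¹) := by
  obtain ⟨σ₀, hσ₀, h8⟩ := thm8_multiLevelTorus_V1 d ℓ hd hL hb₀ hb₁
  obtain ⟨B₀', M', hB₀', hM', hsc⟩ := dE_potential_bound_printed d ℓ hd hL
  refine ⟨σ₀, hσ₀, fun σ hσ hσle α hα0 hα1 => ?_⟩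
  obtain ⟨B₁, B₈, M₈, hB₁, -, hM₈, h⟩ := h8 σ hσ hσle α hα0 hα1
  refine ⟨B₁, B₀', max M₈ M', hB₁, hB₀', lt_max_of_lt_left hM₈, ?_⟩
  intro m K Mh k R P' hN D hk hk1 a hMha hM8 hR2 hP hℓ4 hMt cf hcf w hw hwb A' f hRf α₀ α₁ γ hα₀ hα₁ hγ hJ hB hf2
  have hM8t : M₈ ≤ ((ℓ : ℝ) + 1) * Mh := le_trans (le_max_left _ _) hMt
  have hM't : M' ≤ ((ℓ : ℝ) + 1) * Mh := le_trans (le_max_right _ _) hMt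
  have hP4 : ∀ μ, 4 ≤ P' μ := fun μ => le_trans (by omega) (hP μ)
  have hR2' : 2 * (ℓ + 1) ≤ R := by
    have h1 : ℓ + 1 ≤ (ℓ + 1) ^ 2 := by nlinarith
    exact le_trans (Nat.mul_le_mul_left 2 h1) hR2
  have hη : 0 < |cf|⁻¹ := inv_pos.2 (abs_pos.2 hcf)
  obtain ⟨⟨n, ⟨hn, h146⟩, huniq⟩, hall⟩ :=
    h m K hN D hk hk1 hMha hM8 hR2 hP hℓ4 hM8t hcf hw hwb A' f hRf α₀ α₁ hα₀ hα₁ hJ hB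
  obtain ⟨h37, -, hJ3, ⟨g, hg, hgf, -, hsplit, hp1L, -, -⟩, -⟩ := hall n hn h146
  -- the source term under print's size: `|∂g(b)| ≦ B′₀γ(α₀ + α₁)((Lʲ)η)⁻¹`
  have hS0 : 0 ≤ γ * (α₀ + α₁) := mul_nonneg hγ (add_nonneg hα₀ hα₁)
  have hsrc := hsc m K hN D hk hP4 hR2' hM't hcf f g hg hgf (γ * (α₀ + α₁)) hS0 hf2
  have hC : 0 ≤ (B₁ + B₀' * γ) * (α₀ + α₁) :=
    mul_nonneg (add_nonneg (zero_le_one.trans hB₁) (mul_nonneg (zero_le_one.trans hB₀') hγ)) (add_nonneg hα₀ hα₁)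
  have hp1 : ∀ b : PBond (PV d ℓ m K hd hL) 0,
      |WithLp.ofLp (A' - dE cf n) b| ≤ (B₁ + B₀' * γ) * (α₀ + α₁) * (((geomT D).len (blkV1 hN D b) * |cf|⁻¹) ^ 1)⁻¹ := by
    intro b
    rw [hsplit, WithLp.ofLp_add, Pi.add_apply]
    calc |WithLp.ofLp ((A' - dE cf g) - dE cf n) b + WithLp.ofLp (dE cf g) b|
        ≤ |WithLp.ofLp ((A' - dE cf g) - dE cf n) b| + |WithLp.ofLp (dE cf g) b| := abs_add_le _ _
      _ ≤ B₁ * (α₀ + α₁) * (((geomT D).len (blkV1 hN D b) * |cf|⁻¹) ^ 1)⁻¹ +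
            B₀' * (γ * (α₀ + α₁)) * (((geomT D).len (blkV1 hN D b) * |cf|⁻¹) ^ 1)⁻¹ := add_le_add (hp1L b) (hsrc b)
      _ = (B₁ + B₀' * γ) * (α₀ + α₁) * (((geomT D).len (blkV1 hN D b) * |cf|⁻¹) ^ 1)⁻¹ := by ring
  have e1 : (-1 : ℝ) = -((1 : ℕ) : ℝ) := by norm_num
  have hA1 : msup (ℓ + 1) k |cf|⁻¹ (-1) (fun j (b : PBond (PV d ℓ m K hd hL) 0) => j ≤ (blkV1 hN D b).1.1)
      (WithLp.ofLp (A' - dE cf n)) ≤ (B₁ + B₀' * γ) * (α₀ + α₁) := by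
    rw [e1]
    exact msup_le_of_pointwise_blk_eta D (blkV1 hN D) 1 hη hC hp1
  exact ⟨n, ⟨hn, h146, h37, hA1, hp1, hJ3⟩, fun n' h' => huniq n' ⟨h'.1, h'.2.1⟩⟩

end

end Literature.MathematicalPhysics.QuantumFieldTheory.Balaban1983to89.B8Thm8MultiLevelTorus
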